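import Literature.Combinatorics.Optimization.OddCutShellStep
import HarnessLib

/-!
# One level step is one second difference: the shell law of a block statistic

Continuation of `OddCutShellStep.lean` (cell `pnp-psdrank`, lit g31; LIT-44). Fix a perfect matching,
recorded as a fixed-point-free involution `π` (the partner map), a `π`-stable ground set `S` of
vertices (the vertex set of a sub-matching: deleting edges is `S ↦ S ∖ e ∖ e′`), a block `H` of
vertices and a cut size. Rothvoß's level classes [Rothvoß, *The matching polytope has exponential
extension complexity*, J. ACM 64 (2017), §2] restricted to one matching are the shells
`Shell_S(t,c) = {U ⊆ S : |U| = t, |half(U)| = c}` (`c` = number of matching edges crossing `U`), and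
the **shell law of the block statistic** `X = |U ∩ H|` is the count
`Sh_S(t,c;x) = #{U ∈ Shell_S(t,c) : |U ∩ H| = x}` (`shellCount`).

Sort the vertices of `S` by the `H`-type of their matching edge: `AA` (both endpoints in `H`),
`DD` (both outside), `BH` / `BN` (the `H`-endpoint / the other endpoint of a mixed edge)
(`vAA`, `vDD`, `vBH`, `vBN`). The main theorem of this file (`levelStep_shellCount`) is the exact
identity
  `(c+2)(c+1) · Sh_S(t+2, c+2; x) − (t+2−c)(|S|−t−2−c) · Sh_S(t+2, c; x) = −∇²[G](x)`,
  `G(x) = Σ_{v ∈ AA} Σ_{w ∈ DD} Sh_{S∖{v,πv,w,πw}}(t, c; x) − Σ_{v ∈ BH} Σ_{w ∈ BN, w ≠ πv} Sh_{S∖{v,πv,w,πw}}(t, c; x)`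
(`delStep`; `∇²G(x) = G(x) − 2G(x−1) + G(x−2)`): ONE STEP IN THE LEVEL `c` IS ONE SECOND DIFFERENCE
IN `x`, applied to the shell laws of the sub-matchings with one `HH` and one `H̄H̄` edge deleted
(weight `+`, `4ad` ordered choices for a matching of `H`-type `(a,b,d)`) resp. two mixed edges
deleted (weight `−`, `b(b−1)` choices). Dividing by `(c+2)(c+1)|Shell_S(t+2,c+2)| =
(t+2−c)(|S|−t−2−c)|Shell_S(t+2,c)|` (`shellStepIn_card`) this reads, for the probability laws,
`law_{c+2} − law_c = −(1/(N(N−1)))·∇²[a d · avg_{AD} law′ − (b(b−1)/4) · avg_{BB} law″]` (`N = |S|/2`):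
no first-order drift (the mean of `X` is exactly `c`-free), and the second-order term carries the
discriminant `ad − b²/4` of the type, which vanishes for product types. In generating-function
terms: with `f = αz² + βz + δ` (a full edge), `g = αz + β(1+z)/2 + δ` (a half edge) and
`e = α + β + δ` (an untouched edge) one has `f·e − g² = (αδ − β²/4)(z − 1)²`.

Proof (§3–§5, a double count, no generating functions): by the shell-step identity of
`OddCutShellStep` (move bijection `(U,b,a) ↦ U − b + a`, here relative to the ground set `S`:
`shellStepIn_sum`) and `|(U − b + a) ∩ H| = |U ∩ H| + [a ∈ H] − [b ∈ H]`, the left side equals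
`[F₀₁(x−1) − F₀₁(x)] + [F₁₀(x+1) − F₁₀(x)]` with the FLUXES `F₀₁(x) = Σ_{X(U)=x} |full(U)∖H|·|free(U)∩H|`,
`F₁₀(x) = Σ_{X(U)=x} |full(U)∩H|·|free(U)∖H|` (`flux01`, `flux10`, `levelStep_eq_flux`); deleting the
full edge at `b` and the untouched edge at `a` (`pinned_eq_shellCount`) sorts each flux into four
type classes, the mixed classes cancel, and `F₀₁(x) − F₁₀(x+1) = G(x) − G(x−1)`
(`flux01_sub_flux10`). All PROVED, 0 sorry, no named facts; nothing here is specific to the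
cell's designs (it is bookkeeping on Rothvoß's slack-matrix combinatorics).

USE (cell pnp-psdrank, eng MEMO-18 §2.8/§5 (P2), prover bricks 110a–c; LIT-44): iterating (the level
step commutes with deletion),
`Δ^m_{(2)} law_c = ((−1)^m / (4^m (N)_{2m})) · ∇^{2m}[signed m-fold deletion sum of shell laws]`, so
`‖Δ^m_{(2)} law_c‖_TV ≤ 4^{−m} (N^{2m}/(N)_{2m}) · max_{2m edges deleted} ‖∇^{2m} law′‖_TV`: smoothness of
a shell profile IN THE LEVEL is exactly local-CLT smoothness IN `x` of fixed-level shell laws.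
§6 types this iteration as an operator identity on profiles (`liter_prof_eq`); §7 proves that shell
sizes depend only on `(|S|, t, c)` (`card_shellIn_eq_of_card_eq`, by the one-edge recursion
`card_shellIn_decomp`), the two-edge size ratio
`|S|(|S|−2)·|Shell_{S∖2e}(t,c)| = (t+2−c)(|S|−t−2−c)·|Shell_S(t+2,c)|` (`card_shellIn_del2_ratio`), and
the level step for the probability LAWS `shellLaw = shellCount/|Shell|` in the displayed normalised
form (`levelStep_shellLaw`, normaliser `|S|(|S|−2) = 4N(N−1)`); §8 is its total-variation (`ℓ¹`) form
`levelStep_shellLaw_l1`/`levelStep_shellLaw_l1_le`: `Σ_x |law_{c+2} − law_c| ≤ ((|AA||DD| + |BH||BN|)/(|S|(|S|−2)))·max_e,e′ ‖∇² law_{S∖e∖e′}‖_{ℓ¹}`;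
§9 is the half-set decomposition `shellCount_eq_sum_halfSets`: `Sh_S(t,c;x) = Σ_{Y ∈ halfSets(S,c)} Sh_{S∖(Y∪πY)}(t−c,0; x−|Y∩H|)`
(every shell law is a mixture of shifted level-`0` laws; at level `0`, `X = 2·#{HH edges} + #{mixed edges}`,
`card_inter_eq_of_level_zero`) — the entry point for `x`-smoothness via hypergeometric (Bernoulli-sum) laws;
§10 identifies level-`0` shells with edge subsets (`reps`/`close`, `card_shellIn_zero`: `|Shell_C(2k,0)| = C(#edges, k)`),
splits off a `π`-stable class (`card_shellIn_zero_split`) and proves the three-type product count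
`card_shellIn_zero_types`: `#{W ∈ Shell_S(2(α+β+γ),0) : α HH edges, β mixed} = C(a,α)·C(b,β)·C(d,γ)` — conditionally on
the number of `HH` edges the number of mixed edges is hypergeometric.

## References

* [Rothvoss2017] T. Rothvoß, *The matching polytope has exponential extension complexity*,
  J. ACM 64 (2017), §2 (PDF pp. 5–6): cuts, matchings, the crossing number `|δ(U) ∩ M|`, the level
  classes.
* [GodsilMeagher2015] C. Godsil, K. Meagher, *Erdős–Ko–Rado Theorems: Algebraic Approaches*, CUP
  2015, §15.2 (perfect matchings of `K_{2m}`, partners, the wreath-product symmetry).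
-/

noncomputable section

open Finset

namespace Literature.Combinatorics.Optimization

namespace ShellStep

variable {n : ℕ} (π : Fin n → Fin n)

/-! ### §1 Shells inside a ground set, the shell law of a block statistic, vertex types -/

/-- The free vertices of `U` inside the ground set `S`: `v ∈ S ∖ U` with `π v ∉ U` (endpoints of the
edges of `S` untouched by `U`). [cite: Rothvoss2017, §2 (PDF p. 5)] -/
def freeIn (S U : Finset (Fin n)) : Finset (Fin n) := (S \ U).filter fun v => π v ∉ U

/-- The shell inside `S`: `Shell_S(t,c) = {U ⊆ S : |U| = t, |half(U)| = c}`.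
[cite: Rothvoss2017, §2 (PDF p. 6)] -/
def shellIn (S : Finset (Fin n)) (t c : ℕ) : Finset (Finset (Fin n)) :=
  S.powerset.filter fun U => U.card = t ∧ (half π U).card = c

/-- The shell law (as a count) of the block statistic `|U ∩ H|`:
`Sh_S(t,c;x) = #{U ∈ Shell_S(t,c) : |U ∩ H| = x}`, for `x ∈ ℤ` (zero off `[0, t]`).
[cite: Rothvoss2017, §2 (PDF p. 6)] -/
def shellCount (S H : Finset (Fin n)) (t c : ℕ) (x : ℤ) : ℝ :=
  (((shellIn π S t c).filter fun U => ((U ∩ H).card : ℤ) = x).card : ℝ)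

/-- Vertices of `S` on an `HH` edge (`v ∈ H`, `π v ∈ H`). [cite: Rothvoss2017, §2 (PDF p. 5)] -/
def vAA (S H : Finset (Fin n)) : Finset (Fin n) := S.filter fun v => v ∈ H ∧ π v ∈ H

/-- Vertices of `S` on an `H̄H̄` edge (`v ∉ H`, `π v ∉ H`). [cite: Rothvoss2017, §2 (PDF p. 5)] -/
def vDD (S H : Finset (Fin n)) : Finset (Fin n) := S.filter fun v => v ∉ H ∧ π v ∉ H

/-- The `H`-endpoints of the mixed edges of `S` (`v ∈ H`, `π v ∉ H`). [cite: Rothvoss2017, §2 (PDF p. 5)] -/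
def vBH (S H : Finset (Fin n)) : Finset (Fin n) := S.filter fun v => v ∈ H ∧ π v ∉ H

/-- The non-`H` endpoints of the mixed edges of `S` (`v ∉ H`, `π v ∈ H`). [cite: Rothvoss2017, §2 (PDF p. 5)] -/
def vBN (S H : Finset (Fin n)) : Finset (Fin n) := S.filter fun v => v ∉ H ∧ π v ∈ H

/-- Deleting the two matching edges at `v` and at `w` from the ground set.
[cite: GodsilMeagher2015, §15.2] -/
def del2 (S : Finset (Fin n)) (v w : Fin n) : Finset (Fin n) := S \ {v, π v, w, π w}

/-- The signed deletion sum `G(x) = Σ_{v ∈ AA} Σ_{w ∈ DD} Sh_{S∖{v,πv,w,πw}}(t,c;x)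
− Σ_{v ∈ BH} Σ_{w ∈ BN, w ≠ π v} Sh_{S∖{v,πv,w,πw}}(t,c;x)` (one `HH` and one `H̄H̄` edge deleted, with
the `4ad` orientations; two distinct mixed edges deleted, `b(b−1)` ordered choices).
[cite: Rothvoss2017, §2 (PDF p. 6)] -/
def delStep (S H : Finset (Fin n)) (t c : ℕ) (x : ℤ) : ℝ :=
  (∑ v ∈ vAA π S H, ∑ w ∈ vDD π S H, shellCount π (del2 π S v w) H t c x) -
    ∑ v ∈ vBH π S H, ∑ w ∈ (vBN π S H).erase (π v), shellCount π (del2 π S v w) H t c x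

/-- The flux `F₀₁(x) = Σ_{U ∈ Shell_S(t,c), |U∩H| = x} |full(U) ∖ H| · |free_S(U) ∩ H|` (moves that raise
`|U ∩ H|`). [cite: Rothvoss2017, §2 (PDF p. 6)] -/
def flux01 (S H : Finset (Fin n)) (t c : ℕ) (x : ℤ) : ℝ :=
  ∑ U ∈ shellIn π S t c, ∑ _b ∈ full π U \ H, ∑ _a ∈ freeIn π S U ∩ H,
    if ((U ∩ H).card : ℤ) = x then (1 : ℝ) else 0

/-- The flux `F₁₀(x) = Σ_{U ∈ Shell_S(t,c), |U∩H| = x} |full(U) ∩ H| · |free_S(U) ∖ H|` (moves that lower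
`|U ∩ H|`). [cite: Rothvoss2017, §2 (PDF p. 6)] -/
def flux10 (S H : Finset (Fin n)) (t c : ℕ) (x : ℤ) : ℝ :=
  ∑ U ∈ shellIn π S t c, ∑ _b ∈ full π U ∩ H, ∑ _a ∈ freeIn π S U \ H,
    if ((U ∩ H).card : ℤ) = x then (1 : ℝ) else 0

/-- Forward triples inside `S`: `U ∈ Shell_S(t,c)`, `b ∈ full(U)`, `a ∈ free_S(U)`.
[cite: Rothvoss2017, §2 (PDF p. 6)] -/
def fwdTriplesIn (S : Finset (Fin n)) (t c : ℕ) : Finset (Finset (Fin n) × Fin n × Fin n) :=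
  (shellIn π S t c ×ˢ (S ×ˢ S)).filter fun x => x.2.1 ∈ full π x.1 ∧ x.2.2 ∈ freeIn π S x.1

/-- Backward triples inside `S`: `U′ ∈ Shell_S(t,c+2)`, `a ≠ h` both in `half(U′)`.
[cite: Rothvoss2017, §2 (PDF p. 6)] -/
def bwdTriplesIn (S : Finset (Fin n)) (t c : ℕ) : Finset (Finset (Fin n) × Fin n × Fin n) :=
  (shellIn π S t (c + 2) ×ˢ (S ×ˢ S)).filter
    fun x => x.2.1 ∈ half π x.1 ∧ x.2.2 ∈ half π x.1 ∧ x.2.1 ≠ x.2.2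

variable {π}

/-- Membership in `freeIn`. [cite: Rothvoss2017, §2 (PDF p. 5)] -/
@[simp] theorem mem_freeIn {S U : Finset (Fin n)} {v : Fin n} :
    v ∈ freeIn π S U ↔ v ∈ S ∧ v ∉ U ∧ π v ∉ U := by
  simp [freeIn, and_assoc]

/-- Membership in `shellIn`. [cite: Rothvoss2017, §2 (PDF p. 6)] -/
@[simp] theorem mem_shellIn {S : Finset (Fin n)} {t c : ℕ} {U : Finset (Fin n)} :
    U ∈ shellIn π S t c ↔ U ⊆ S ∧ U.card = t ∧ (half π U).card = c := by
  simp [shellIn]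

/-- Membership in `vAA`. [cite: Rothvoss2017, §2 (PDF p. 5)] -/
@[simp] theorem mem_vAA {S H : Finset (Fin n)} {v : Fin n} :
    v ∈ vAA π S H ↔ v ∈ S ∧ v ∈ H ∧ π v ∈ H := by simp [vAA]

/-- Membership in `vDD`. [cite: Rothvoss2017, §2 (PDF p. 5)] -/
@[simp] theorem mem_vDD {S H : Finset (Fin n)} {v : Fin n} :
    v ∈ vDD π S H ↔ v ∈ S ∧ v ∉ H ∧ π v ∉ H := by simp [vDD]

/-- Membership in `vBH`. [cite: Rothvoss2017, §2 (PDF p. 5)] -/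
@[simp] theorem mem_vBH {S H : Finset (Fin n)} {v : Fin n} :
    v ∈ vBH π S H ↔ v ∈ S ∧ v ∈ H ∧ π v ∉ H := by simp [vBH]

/-- Membership in `vBN`. [cite: Rothvoss2017, §2 (PDF p. 5)] -/
@[simp] theorem mem_vBN {S H : Finset (Fin n)} {v : Fin n} :
    v ∈ vBN π S H ↔ v ∈ S ∧ v ∉ H ∧ π v ∈ H := by simp [vBN]

/-- Membership in `del2`. [cite: GodsilMeagher2015, §15.2] -/
@[simp] theorem mem_del2 {S : Finset (Fin n)} {v w u : Fin n} :
    u ∈ del2 π S v w ↔ u ∈ S ∧ u ≠ v ∧ u ≠ π v ∧ u ≠ w ∧ u ≠ π w := by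
  simp [del2, not_or]

/-- Membership in `fwdTriplesIn`. [cite: Rothvoss2017, §2 (PDF p. 6)] -/
@[simp] theorem mem_fwdTriplesIn {S : Finset (Fin n)} {t c : ℕ} {x : Finset (Fin n) × Fin n × Fin n} :
    x ∈ fwdTriplesIn π S t c ↔ x.1 ∈ shellIn π S t c ∧ x.2.1 ∈ full π x.1 ∧ x.2.2 ∈ freeIn π S x.1 := by
  simp only [fwdTriplesIn, mem_filter, mem_product]
  constructor
  · rintro ⟨⟨hU, _, _⟩, hb, ha⟩; exact ⟨hU, hb, ha⟩
  · rintro ⟨hU, hb, ha⟩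
    exact ⟨⟨hU, (mem_shellIn.1 hU).1 (mem_full.1 hb).1, (mem_freeIn.1 ha).1⟩, hb, ha⟩

/-- Membership in `bwdTriplesIn`. [cite: Rothvoss2017, §2 (PDF p. 6)] -/
@[simp] theorem mem_bwdTriplesIn {S : Finset (Fin n)} {t c : ℕ} {x : Finset (Fin n) × Fin n × Fin n} :
    x ∈ bwdTriplesIn π S t c ↔
      x.1 ∈ shellIn π S t (c + 2) ∧ x.2.1 ∈ half π x.1 ∧ x.2.2 ∈ half π x.1 ∧ x.2.1 ≠ x.2.2 := by
  simp only [bwdTriplesIn, mem_filter, mem_product]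
  constructor
  · rintro ⟨⟨hU, _, _⟩, ha, hh, hah⟩; exact ⟨hU, ha, hh, hah⟩
  · rintro ⟨hU, ha, hh, hah⟩
    exact ⟨⟨hU, (mem_shellIn.1 hU).1 (mem_half.1 ha).1, (mem_shellIn.1 hU).1 (mem_half.1 hh).1⟩,
      ha, hh, hah⟩

/-- `free_S(U) ⊆ free(U)`. [cite: Rothvoss2017, §2 (PDF p. 5)] -/
theorem freeIn_subset_free (S U : Finset (Fin n)) : freeIn π S U ⊆ free π U := fun v hv => by
  rw [mem_freeIn] at hv; exact mem_free.2 ⟨hv.2.1, hv.2.2⟩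

/-- `del2` is symmetric in the two deleted edges. [cite: GodsilMeagher2015, §15.2] -/
theorem del2_comm (S : Finset (Fin n)) (v w : Fin n) : del2 π S v w = del2 π S w v := by
  ext u; simp only [mem_del2]; tauto

/-- The shell count as a sum of indicators. [cite: Rothvoss2017, §2 (PDF p. 6)] -/
theorem shellCount_eq_sum (S H : Finset (Fin n)) (t c : ℕ) (x : ℤ) :
    shellCount π S H t c x = ∑ U ∈ shellIn π S t c, if ((U ∩ H).card : ℤ) = x then (1 : ℝ) else 0 := by
  rw [shellCount, card_filter]
  push_cast
  rfl

/-- `|full(U)| = t − c` on the shell. [cite: Rothvoss2017, §2 (PDF p. 6)] -/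
theorem card_full_of_mem_shellIn {S : Finset (Fin n)} {t c : ℕ} {U : Finset (Fin n)}
    (hU : U ∈ shellIn π S t c) : (full π U).card = t - c := by
  obtain ⟨_, ht, hc⟩ := mem_shellIn.1 hU
  have := card_full_add_card_half (π := π) U
  omega

/-- `c ≤ t` on a nonempty shell. [cite: Rothvoss2017, §2 (PDF p. 6)] -/
theorem le_of_mem_shellIn {S : Finset (Fin n)} {t c : ℕ} {U : Finset (Fin n)}
    (hU : U ∈ shellIn π S t c) : c ≤ t := by
  obtain ⟨_, ht, hc⟩ := mem_shellIn.1 hU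
  have := card_le_card (half_subset (π := π) U)
  omega

section Involution

variable (hπ : ∀ v, π (π v) = v)
include hπ

/-- The vertices of `S ∖ U` with partner inside `U` are the partners of the half-matched vertices
(for `U ⊆ S`, `S` stable under `π`). [cite: Rothvoss2017, §2 (PDF p. 5)] -/
theorem sdiff_filter_eq_image_half {S U : Finset (Fin n)} (hS : ∀ v ∈ S, π v ∈ S) (hU : U ⊆ S) :
    (S \ U).filter (fun v => π v ∈ U) = (half π U).image π := by
  ext v
  simp only [mem_filter, mem_sdiff, mem_image, mem_half]
  constructor
  · rintro ⟨⟨_, hvU⟩, hπv⟩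
    exact ⟨π v, ⟨hπv, by rwa [hπ]⟩, hπ v⟩
  · rintro ⟨w, ⟨hw, hπw⟩, rfl⟩
    exact ⟨⟨hS w (hU hw), hπw⟩, by rwa [hπ]⟩

/-- `|half(U)| + |free_S(U)| = |S| − |U|` for `U ⊆ S`. [cite: Rothvoss2017, §2 (PDF p. 5)] -/
theorem card_half_add_card_freeIn {S U : Finset (Fin n)} (hS : ∀ v ∈ S, π v ∈ S) (hU : U ⊆ S) :
    (half π U).card + (freeIn π S U).card = S.card - U.card := by
  have h1 : ((S \ U).filter fun v => π v ∈ U).card = (half π U).card := by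
    rw [sdiff_filter_eq_image_half hπ hS hU, card_image_of_injective _ (π_injective hπ)]
  have h2 := card_filter_add_card_filter_not (s := S \ U) (fun v => π v ∈ U)
  rw [h1, card_sdiff_of_subset hU] at h2
  exact h2

/-- `|free_S(U)| = |S| − t − c` on the shell. [cite: Rothvoss2017, §2 (PDF p. 6)] -/
theorem card_freeIn_of_mem_shellIn {S : Finset (Fin n)} (hS : ∀ v ∈ S, π v ∈ S) {t c : ℕ}
    {U : Finset (Fin n)} (hU : U ∈ shellIn π S t c) : (freeIn π S U).card = S.card - t - c := by
  obtain ⟨hUS, ht, hc⟩ := mem_shellIn.1 hU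
  have := card_half_add_card_freeIn hπ hS hUS
  omega

/-- `t + c ≤ |S|` on a nonempty shell. [cite: Rothvoss2017, §2 (PDF p. 6)] -/
theorem add_le_of_mem_shellIn {S : Finset (Fin n)} (hS : ∀ v ∈ S, π v ∈ S) {t c : ℕ}
    {U : Finset (Fin n)} (hU : U ∈ shellIn π S t c) : t + c ≤ S.card := by
  obtain ⟨hUS, ht, hc⟩ := mem_shellIn.1 hU
  have h1 := card_half_add_card_freeIn hπ hS hUS
  have h2 := card_le_card hUS
  omega

variable (hπ' : ∀ v, π v ≠ v)
include hπ'

/-! ### §2 The shell-step identity inside a ground set -/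

/-- The move maps `Shell_S(t,c)` into `Shell_S(t,c+2)`. [cite: Rothvoss2017, §2 (PDF p. 6)] -/
theorem move_mem_shellIn {S : Finset (Fin n)} {t c : ℕ} {U : Finset (Fin n)}
    (hU : U ∈ shellIn π S t c) {b a : Fin n} (hb : b ∈ full π U) (ha : a ∈ freeIn π S U) :
    move U b a ∈ shellIn π S t (c + 2) := by
  obtain ⟨hUS, ht, hc⟩ := mem_shellIn.1 hU
  obtain ⟨haS, haU, _⟩ := mem_freeIn.1 ha
  have hmem := move_mem_shell hπ hπ' (mem_shell.2 ⟨ht, hc⟩) hb (freeIn_subset_free S U ha)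
  obtain ⟨ht', hc'⟩ := mem_shell.1 hmem
  refine mem_shellIn.2 ⟨fun v hv => ?_, ht', hc'⟩
  rcases mem_move.1 hv with rfl | ⟨_, hvU⟩
  · exact haS
  · exact hUS hvU

/-- The reverse move maps `Shell_S(t,c+2)` into `Shell_S(t,c)`. [cite: Rothvoss2017, §2 (PDF p. 6)] -/
theorem unmove_mem_shellIn {S : Finset (Fin n)} (hS : ∀ v ∈ S, π v ∈ S) {t c : ℕ}
    {U' : Finset (Fin n)} (hU' : U' ∈ shellIn π S t (c + 2)) {a h : Fin n} (ha : a ∈ half π U')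
    (hh : h ∈ half π U') (hah : a ≠ h) : move U' a (π h) ∈ shellIn π S t c := by
  obtain ⟨hUS, ht, hc⟩ := mem_shellIn.1 hU'
  have hmem := unmove_mem_shell hπ hπ' (mem_shell.2 ⟨ht, hc⟩) ha hh hah
  obtain ⟨ht', hc'⟩ := mem_shell.1 hmem
  refine mem_shellIn.2 ⟨fun v hv => ?_, ht', hc'⟩
  rcases mem_move.1 hv with rfl | ⟨_, hvU⟩
  · exact hS h (hUS (mem_half.1 hh).1)
  · exact hUS hvU

/-- **The move is a bijection** `fwdTriplesIn ≃ bwdTriplesIn` (ground-set version of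
`sum_fwdTriples_eq_sum_bwdTriples`). [cite: Rothvoss2017, §2 (PDF p. 6)] -/
theorem sum_fwdTriplesIn_eq_sum_bwdTriplesIn {S : Finset (Fin n)} (hS : ∀ v ∈ S, π v ∈ S) (t c : ℕ)
    (F : Finset (Fin n) × Fin n × Fin n → ℝ) :
    ∑ x ∈ fwdTriplesIn π S t c, F (move x.1 x.2.1 x.2.2, x.2.2, π x.2.1) =
      ∑ y ∈ bwdTriplesIn π S t c, F y := by
  refine sum_nbij' (fun x => (move x.1 x.2.1 x.2.2, x.2.2, π x.2.1))
    (fun y => (move y.1 y.2.1 (π y.2.2), π y.2.2, y.2.1)) ?_ ?_ ?_ ?_ fun _ _ => rfl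
  · rintro ⟨U, b, a⟩ hx
    obtain ⟨hU, hb, ha⟩ := mem_fwdTriplesIn.1 hx
    obtain ⟨_, hπb⟩ := mem_full.1 hb
    obtain ⟨_, haU, hπa⟩ := mem_freeIn.1 ha
    have ha' : a ∈ free π U := mem_free.2 ⟨haU, hπa⟩
    refine mem_bwdTriplesIn.2 ⟨move_mem_shellIn hπ hπ' hU hb ha, ?_, ?_, ?_⟩
    · rw [half_move hπ hπ' hb ha']; exact mem_insert_self _ _
    · rw [half_move hπ hπ' hb ha']; exact mem_insert_of_mem (mem_insert_self _ _)
    · show a ≠ π b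
      exact fun h => haU (by rw [h]; exact hπb)
  · rintro ⟨U', a, h⟩ hy
    obtain ⟨hU', ha, hh, hah⟩ := mem_bwdTriplesIn.1 hy
    obtain ⟨haU, hπa⟩ := mem_half.1 ha
    obtain ⟨hhU, hπh⟩ := mem_half.1 hh
    have hU'S := (mem_shellIn.1 hU').1
    have hπha : π h ≠ a := fun e => hπh (e ▸ haU)
    refine mem_fwdTriplesIn.2 ⟨unmove_mem_shellIn hπ hπ' hS hU' ha hh hah, ?_, ?_⟩
    · refine mem_full.2 ⟨mem_move.2 (Or.inl rfl), ?_⟩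
      rw [hπ]; exact mem_move.2 (Or.inr ⟨hah.symm, hhU⟩)
    · refine mem_freeIn.2 ⟨hU'S haU, ?_, ?_⟩
      · rw [mem_move, not_or]; exact ⟨hπha.symm, fun h' => h'.1 rfl⟩
      · rw [mem_move, not_or]
        exact ⟨fun e => hah (π_injective hπ e), fun h' => hπa h'.2⟩
  · rintro ⟨U, b, a⟩ hx
    obtain ⟨_, hb, ha⟩ := mem_fwdTriplesIn.1 hx
    obtain ⟨hbU, _⟩ := mem_full.1 hb
    obtain ⟨_, haU, _⟩ := mem_freeIn.1 ha
    have h1 : a ∉ U.erase b := fun h => haU (mem_of_mem_erase h)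
    simp only [hπ, move, erase_insert h1, insert_erase hbU]
  · rintro ⟨U', a, h⟩ hy
    obtain ⟨_, ha, hh, _⟩ := mem_bwdTriplesIn.1 hy
    obtain ⟨haU, _⟩ := mem_half.1 ha
    obtain ⟨_, hπh⟩ := mem_half.1 hh
    have h1 : π h ∉ U'.erase a := fun h' => hπh (mem_of_mem_erase h')
    simp only [hπ, move, erase_insert h1, insert_erase haU]

omit hπ hπ' in
/-- Iterated form of the forward sum. [cite: Rothvoss2017, §2 (PDF p. 6)] -/
theorem sum_fwdTriplesIn_eq {S : Finset (Fin n)} (t c : ℕ) (G : Finset (Fin n) × Fin n × Fin n → ℝ) :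
    ∑ x ∈ fwdTriplesIn π S t c, G x =
      ∑ U ∈ shellIn π S t c, ∑ b ∈ full π U, ∑ a ∈ freeIn π S U, G (U, b, a) := by
  rw [fwdTriplesIn, sum_filter, sum_product]
  refine sum_congr rfl fun U hU => ?_
  have hfull : full π U ⊆ S := fun b hb => (mem_shellIn.1 hU).1 (mem_full.1 hb).1
  have hfree : freeIn π S U ⊆ S := fun a ha => (mem_freeIn.1 ha).1
  rw [sum_product]
  dsimp only
  rw [← sum_filter_add_sum_filter_not S (fun b => b ∈ full π U), filter_mem_eq_inter,
    inter_eq_right.2 hfull,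
    sum_eq_zero (s := S.filter fun b => b ∉ full π U) (fun b hb => by
      rw [mem_filter] at hb
      exact sum_eq_zero fun a _ => if_neg fun h => hb.2 h.1), add_zero]
  refine sum_congr rfl fun b hb => ?_
  rw [← sum_filter_add_sum_filter_not S (fun a => a ∈ freeIn π S U), filter_mem_eq_inter,
    inter_eq_right.2 hfree,
    sum_eq_zero (s := S.filter fun a => a ∉ freeIn π S U) (fun a ha => by
      rw [mem_filter] at ha; exact if_neg fun h => ha.2 h.2), add_zero]
  exact sum_congr rfl fun a ha => if_pos ⟨hb, ha⟩

omit hπ hπ' in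
/-- Iterated form of the backward sum: `Σ_{(U′,a,h)} g(U′) = (c+2)(c+1) Σ_{U′} g(U′)`.
[cite: Rothvoss2017, §2 (PDF p. 6)] -/
theorem sum_bwdTriplesIn_eq {S : Finset (Fin n)} (t c : ℕ) (g : Finset (Fin n) → ℝ) :
    ∑ y ∈ bwdTriplesIn π S t c, g y.1 =
      ((c + 2) * (c + 1) : ℝ) * ∑ U' ∈ shellIn π S t (c + 2), g U' := by
  rw [bwdTriplesIn, sum_filter, sum_product, mul_sum]
  refine sum_congr rfl fun U' hU' => ?_
  obtain ⟨hUS, _, hc⟩ := mem_shellIn.1 hU'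
  have hsub : half π U' ⊆ S := fun v hv => hUS (mem_half.1 hv).1
  dsimp only
  have hcount : ∑ y ∈ S ×ˢ S,
      (if y.1 ∈ half π U' ∧ y.2 ∈ half π U' ∧ y.1 ≠ y.2 then (1 : ℝ) else 0) = (c + 2) * (c + 1) := by
    rw [← sum_filter, sum_const, nsmul_eq_mul, mul_one]
    have : (S ×ˢ S).filter (fun y => y.1 ∈ half π U' ∧ y.2 ∈ half π U' ∧ y.1 ≠ y.2) =
        (half π U').offDiag := by
      ext y
      simp only [mem_filter, mem_product, mem_offDiag]
      constructor
      · rintro ⟨_, h1, h2, h3⟩; exact ⟨h1, h2, h3⟩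
      · rintro ⟨h1, h2, h3⟩; exact ⟨⟨hsub h1, hsub h2⟩, h1, h2, h3⟩
    rw [this, offDiag_card, hc]
    have h2 : (c + 2) ≤ (c + 2) * (c + 2) := Nat.le_mul_self _
    push_cast [Nat.cast_sub h2]
    ring
  calc ∑ y ∈ S ×ˢ S, (if y.1 ∈ half π U' ∧ y.2 ∈ half π U' ∧ y.1 ≠ y.2 then g U' else 0)
      = ∑ y ∈ S ×ˢ S,
          g U' * (if y.1 ∈ half π U' ∧ y.2 ∈ half π U' ∧ y.1 ≠ y.2 then (1 : ℝ) else 0) :=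
        sum_congr rfl fun y _ => by split_ifs <;> simp
    _ = g U' * ((c + 2) * (c + 1)) := by rw [← mul_sum, hcount]
    _ = (c + 2) * (c + 1) * g U' := by ring

/-- **The shell-step identity inside a ground set**: for every cut statistic `g`,
`(c+2)(c+1) · Σ_{U′ ∈ Shell_S(t,c+2)} g(U′) = Σ_{U ∈ Shell_S(t,c)} Σ_{b ∈ full(U)} Σ_{a ∈ free_S(U)} g(U − b + a)`.
[cite: Rothvoss2017, §2 (PDF p. 6)] -/
theorem shellStepIn_sum {S : Finset (Fin n)} (hS : ∀ v ∈ S, π v ∈ S) (t c : ℕ)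
    (g : Finset (Fin n) → ℝ) :
    ((c + 2) * (c + 1) : ℝ) * ∑ U' ∈ shellIn π S t (c + 2), g U' =
      ∑ U ∈ shellIn π S t c, ∑ b ∈ full π U, ∑ a ∈ freeIn π S U, g (move U b a) := by
  rw [← sum_bwdTriplesIn_eq, ← sum_fwdTriplesIn_eq_sum_bwdTriplesIn hπ hπ' hS t c (fun y => g y.1),
    sum_fwdTriplesIn_eq]

/-- **Bi-regularity of adjacent shells inside a ground set**:
`(c+2)(c+1) · |Shell_S(t,c+2)| = (t−c)(|S|−t−c) · |Shell_S(t,c)|`. [cite: Rothvoss2017, §2 (PDF p. 6)] -/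
theorem shellStepIn_card {S : Finset (Fin n)} (hS : ∀ v ∈ S, π v ∈ S) (t c : ℕ) :
    ((c + 2) * (c + 1) : ℝ) * (shellIn π S t (c + 2)).card =
      ((t : ℝ) - c) * ((S.card : ℝ) - t - c) * (shellIn π S t c).card := by
  have h := shellStepIn_sum hπ hπ' hS t c (fun _ => (1 : ℝ))
  simp only [sum_const, nsmul_eq_mul, mul_one] at h
  rw [h, show ((t : ℝ) - c) * ((S.card : ℝ) - t - c) * (shellIn π S t c).card =
      ∑ U ∈ shellIn π S t c, ((t : ℝ) - c) * ((S.card : ℝ) - t - c) by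
    rw [sum_const, nsmul_eq_mul]; ring]
  refine sum_congr rfl fun U hU => ?_
  have h3 := le_of_mem_shellIn hU
  have h4 := add_le_of_mem_shellIn hπ hS hU
  rw [card_full_of_mem_shellIn hU, card_freeIn_of_mem_shellIn hπ hS hU, Nat.cast_sub h3,
    Nat.cast_sub (by omega), Nat.cast_sub (by omega)]


/-! ### §3 The level step in terms of the fluxes -/

omit hπ hπ' in
/-- Splitting a sum over a vertex set along `H`. [cite: Rothvoss2017, §2 (PDF p. 5)] -/
theorem sum_split_mem (s H : Finset (Fin n)) (F : Fin n → ℝ) :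
    ∑ v ∈ s, F v = ∑ v ∈ s ∩ H, F v + ∑ v ∈ s \ H, F v := by
  rw [← sum_filter_add_sum_filter_not s (fun v => v ∈ H), filter_mem_eq_inter]
  congr 1
  refine sum_congr ?_ fun _ _ => rfl
  ext v; simp [mem_sdiff]

/-- **The level step in terms of the fluxes**:
`(c+2)(c+1)·Sh_S(t,c+2;x) − (t−c)(|S|−t−c)·Sh_S(t,c;x) = [F₀₁(x−1) − F₀₁(x)] + [F₁₀(x+1) − F₁₀(x)]`
(shell step with `g = 1[|·∩H| = x]` and `|(U−b+a) ∩ H| = |U ∩ H| + [a ∈ H] − [b ∈ H]`).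
[cite: Rothvoss2017, §2 (PDF p. 6)] -/
theorem levelStep_eq_flux {S : Finset (Fin n)} (hS : ∀ v ∈ S, π v ∈ S) (H : Finset (Fin n))
    (t c : ℕ) (x : ℤ) :
    ((c + 2) * (c + 1) : ℝ) * shellCount π S H t (c + 2) x
        - ((t : ℝ) - c) * ((S.card : ℝ) - t - c) * shellCount π S H t c x =
      (flux01 π S H t c (x - 1) - flux01 π S H t c x)
        + (flux10 π S H t c (x + 1) - flux10 π S H t c x) := by
  -- the indicator of the event `|· ∩ H| = x`
  set ind : Finset (Fin n) → ℝ := fun U => if ((U ∩ H).card : ℤ) = x then (1 : ℝ) else 0 with hind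
  -- Step 1: the upper shell count through the moves
  have step1 : ((c + 2) * (c + 1) : ℝ) * shellCount π S H t (c + 2) x =
      ∑ U ∈ shellIn π S t c, ∑ b ∈ full π U, ∑ a ∈ freeIn π S U, ind (move U b a) := by
    rw [shellCount_eq_sum]
    exact shellStepIn_sum hπ hπ' hS t c ind
  -- Step 2: the lower shell count, weighted by the number of moves
  have step2 : ((t : ℝ) - c) * ((S.card : ℝ) - t - c) * shellCount π S H t c x =
      ∑ U ∈ shellIn π S t c, ∑ _b ∈ full π U, ∑ _a ∈ freeIn π S U, ind U := by
    rw [shellCount_eq_sum, mul_sum]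
    refine sum_congr rfl fun U hU => ?_
    have h3 := le_of_mem_shellIn hU
    have h4 := add_le_of_mem_shellIn hπ hS hU
    simp only [sum_const, nsmul_eq_mul]
    rw [card_full_of_mem_shellIn hU, card_freeIn_of_mem_shellIn hπ hS hU, Nat.cast_sub h3,
      Nat.cast_sub (by omega), Nat.cast_sub (by omega)]
    ring
  -- Step 3: the value of the moved indicator
  have hval : ∀ U ∈ shellIn π S t c, ∀ b ∈ full π U, ∀ a ∈ freeIn π S U,
      ind (move U b a) =
        if ((U ∩ H).card : ℤ) + (if a ∈ H then 1 else 0) - (if b ∈ H then 1 else 0) = x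
        then (1 : ℝ) else 0 := by
    intro U _ b hb a ha
    simp only [hind]
    rw [card_move_inter U H (mem_full.1 hb).1 (mem_freeIn.1 ha).2.1]
  rw [step1, step2, ← sum_sub_distrib]
  simp only [flux01, flux10, ← sum_sub_distrib]
  rw [← sum_add_distrib]
  refine sum_congr rfl fun U hU => ?_
  -- split the `b`-sum and the `a`-sum along `H`
  rw [sum_split_mem (full π U) H, add_comm]
  congr 1
  · -- b ∉ H : only `a ∈ H` contributes, with `1[X = x-1] − 1[X = x]`
    refine sum_congr rfl fun b hb => ?_
    obtain ⟨hbf, hbH⟩ := mem_sdiff.1 hb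
    rw [sum_split_mem (freeIn π S U) H,
      sum_eq_zero (s := freeIn π S U \ H) (fun a ha => by
        obtain ⟨haf, haH⟩ := mem_sdiff.1 ha
        rw [hval U hU b hbf a haf, if_neg haH, if_neg hbH]; simp [hind]), add_zero]
    refine sum_congr rfl fun a ha => ?_
    obtain ⟨haf, haH⟩ := mem_inter.1 ha
    rw [hval U hU b hbf a haf, if_pos haH, if_neg hbH]
    simp only [hind, sub_zero]
    have e : (((U ∩ H).card : ℤ) + 1 = x) ↔ (((U ∩ H).card : ℤ) = x - 1) := by omega
    simp only [e]
  · -- b ∈ H : only `a ∉ H` contributes, with `1[X = x+1] − 1[X = x]`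
    refine sum_congr rfl fun b hb => ?_
    obtain ⟨hbf, hbH⟩ := mem_inter.1 hb
    rw [sum_split_mem (freeIn π S U) H,
      sum_eq_zero (s := freeIn π S U ∩ H) (fun a ha => by
        obtain ⟨haf, haH⟩ := mem_inter.1 ha
        rw [hval U hU b hbf a haf, if_pos haH, if_pos hbH]; simp [hind]), zero_add]
    refine sum_congr rfl fun a ha => ?_
    obtain ⟨haf, haH⟩ := mem_sdiff.1 ha
    rw [hval U hU b hbf a haf, if_neg haH, if_pos hbH]
    simp only [hind, add_zero]
    have e : (((U ∩ H).card : ℤ) - 1 = x) ↔ (((U ∩ H).card : ℤ) = x + 1) := by omega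
    simp only [e]


/-! ### §4 The fluxes as deletion sums -/

/-- The pinned count: `#{U ∈ Shell_S(T,c) : b ∈ full(U), a ∈ free_S(U), |U ∩ H| = x}`.
[cite: Rothvoss2017, §2 (PDF p. 6)] -/
def pinned (π : Fin n → Fin n) (S H : Finset (Fin n)) (T c : ℕ) (b a : Fin n) (x : ℤ) : ℝ :=
  ((((shellIn π S T c).filter fun U =>
      b ∈ full π U ∧ a ∈ freeIn π S U ∧ ((U ∩ H).card : ℤ) = x).card : ℕ) : ℝ)

omit hπ' in
/-- Removing a full edge keeps the half-matched vertices. [cite: Rothvoss2017, §2 (PDF p. 5)] -/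
theorem half_sdiff_pair {U : Finset (Fin n)} {b : Fin n} (hb : b ∈ U) (hπb : π b ∈ U) :
    half π (U \ {b, π b}) = half π U := by
  ext v
  rw [mem_half, mem_half, mem_sdiff, mem_sdiff]
  simp only [mem_insert, mem_singleton, not_or]
  constructor
  · rintro ⟨⟨hvU, hvb, hvπb⟩, h2⟩
    refine ⟨hvU, fun hπvU => h2 ⟨hπvU, ?_, ?_⟩⟩
    · intro e; exact hvπb ((π_eq_iff hπ).1 e)
    · intro e; exact hvb (π_injective hπ e)
  · rintro ⟨hvU, hπvU⟩
    refine ⟨⟨hvU, ?_, ?_⟩, fun h => hπvU h.1⟩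
    · rintro rfl; exact hπvU hπb
    · rintro rfl; rw [hπ] at hπvU; exact hπvU hb

omit hπ hπ' in
/-- The block count after removing a full edge. [cite: Rothvoss2017, §2 (PDF p. 5)] -/
theorem card_inter_sdiff_pair {U : Finset (Fin n)} {b : Fin n} (hb : b ∈ U) (hπb : π b ∈ U)
    (H : Finset (Fin n)) :
    ((((U \ {b, π b}) ∩ H).card : ℕ) : ℤ) = ((U ∩ H).card : ℤ) - (({b, π b} ∩ H).card : ℤ) := by
  have hsub : {b, π b} ∩ H ⊆ U ∩ H := by
    intro v hv
    rw [mem_inter] at hv ⊢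
    rcases mem_insert.1 hv.1 with rfl | h
    · exact ⟨hb, hv.2⟩
    · rw [mem_singleton] at h; subst h; exact ⟨hπb, hv.2⟩
  have e : (U \ {b, π b}) ∩ H = (U ∩ H) \ ({b, π b} ∩ H) := by
    ext v; simp only [mem_inter, mem_sdiff, mem_insert, mem_singleton]; tauto
  rw [e, card_sdiff_of_subset hsub, Nat.cast_sub (card_le_card hsub)]

omit hπ hπ' in
/-- The block count after adding an edge. [cite: Rothvoss2017, §2 (PDF p. 5)] -/
theorem card_inter_union_pair {W : Finset (Fin n)} {b : Fin n} (hb : b ∉ W) (hπb : π b ∉ W)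
    (H : Finset (Fin n)) :
    ((((W ∪ {b, π b}) ∩ H).card : ℕ) : ℤ) = ((W ∩ H).card : ℤ) + (({b, π b} ∩ H).card : ℤ) := by
  rw [union_inter_distrib_right, card_union_of_disjoint]
  · push_cast; ring
  · exact disjoint_left.2 fun v hv hv' => by
      rcases mem_insert.1 (mem_inter.1 hv').1 with rfl | h
      · exact hb (mem_inter.1 hv).1
      · rw [mem_singleton] at h; subst h; exact hπb (mem_inter.1 hv).1

/-- **Pinning two edges is deleting them**: for `b, a ∈ S` on different edges (`a ≠ b`, `a ≠ π b`),
`#{U ∈ Shell_S(t+2,c) : b ∈ full(U), a ∈ free_S(U), |U ∩ H| = x}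
 = #{W ∈ Shell_{S∖{b,πb,a,πa}}(t,c) : |W ∩ H| = x − |{b,πb} ∩ H|}` via `W = U ∖ {b, π b}`.
[cite: Rothvoss2017, §2 (PDF p. 6)] -/
theorem pinned_eq_shellCount {S : Finset (Fin n)} (hS : ∀ v ∈ S, π v ∈ S) (H : Finset (Fin n))
    {b a : Fin n} (hb : b ∈ S) (ha : a ∈ S) (hab : a ≠ b) (haπ : a ≠ π b) (t c : ℕ) (x : ℤ) :
    pinned π S H (t + 2) c b a x =
      shellCount π (del2 π S b a) H t c (x - (({b, π b} ∩ H).card : ℤ)) := by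
  rw [pinned, shellCount]
  congr 1
  have hPsub : ∀ {U : Finset (Fin n)}, b ∈ U → π b ∈ U → ({b, π b} : Finset (Fin n)) ⊆ U :=
    fun hbU hπbU v hv => by
      rcases mem_insert.1 hv with rfl | h
      · exact hbU
      · rw [mem_singleton] at h; subst h; exact hπbU
  have hPcard : ({b, π b} : Finset (Fin n)).card = 2 := card_pair (hπ' b).symm
  refine card_nbij' (fun U => U \ {b, π b}) (fun W => W ∪ {b, π b}) ?_ ?_ ?_ ?_
  · intro U hU
    simp only [mem_coe, mem_filter] at hU ⊢
    obtain ⟨hUsh, hbf, haf, hX⟩ := hU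
    obtain ⟨hUS, hUt, hUc⟩ := mem_shellIn.1 hUsh
    obtain ⟨hbU, hπbU⟩ := mem_full.1 hbf
    obtain ⟨_, haU, hπaU⟩ := mem_freeIn.1 haf
    refine ⟨mem_shellIn.2 ⟨?_, ?_, ?_⟩, ?_⟩
    · intro v hv
      rw [mem_sdiff, mem_insert, mem_singleton, not_or] at hv
      rw [mem_del2]
      refine ⟨hUS hv.1, hv.2.1, hv.2.2, ?_, ?_⟩
      · rintro rfl; exact haU hv.1
      · rintro rfl; exact hπaU hv.1
    · rw [card_sdiff_of_subset (hPsub hbU hπbU), hUt, hPcard]; rfl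
    · rw [half_sdiff_pair hπ hbU hπbU, hUc]
    · rw [card_inter_sdiff_pair hbU hπbU, hX]
  · intro W hW
    simp only [mem_coe, mem_filter] at hW ⊢
    obtain ⟨hWsh, hX⟩ := hW
    obtain ⟨hWS, hWt, hWc⟩ := mem_shellIn.1 hWsh
    have hbW : b ∉ W := fun h => (mem_del2.1 (hWS h)).2.1 rfl
    have hπbW : π b ∉ W := fun h => (mem_del2.1 (hWS h)).2.2.1 rfl
    have haW : a ∉ W := fun h => (mem_del2.1 (hWS h)).2.2.2.1 rfl
    have hπaW : π a ∉ W := fun h => (mem_del2.1 (hWS h)).2.2.2.2 rfl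
    have hbU : b ∈ W ∪ {b, π b} := mem_union_right _ (mem_insert_self _ _)
    have hπbU : π b ∈ W ∪ {b, π b} := mem_union_right _ (mem_insert_of_mem (mem_singleton_self _))
    have hdisj : Disjoint W {b, π b} := disjoint_left.2 fun v hvW hvP => by
      rcases mem_insert.1 hvP with rfl | h
      · exact hbW hvW
      · rw [mem_singleton] at h; subst h; exact hπbW hvW
    have e : (W ∪ {b, π b}) \ {b, π b} = W := by
      rw [union_sdiff_right, sdiff_eq_self_of_disjoint hdisj]
    refine ⟨mem_shellIn.2 ⟨?_, ?_, ?_⟩, mem_full.2 ⟨hbU, hπbU⟩, mem_freeIn.2 ⟨ha, ?_, ?_⟩, ?_⟩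
    · intro v hv
      rcases mem_union.1 hv with h | h
      · exact (mem_del2.1 (hWS h)).1
      · rcases mem_insert.1 h with rfl | h
        · exact hb
        · rw [mem_singleton] at h; subst h; exact hS b hb
    · rw [card_union_of_disjoint hdisj, hWt, hPcard]
    · rw [← half_sdiff_pair hπ hbU hπbU, e, hWc]
    · intro h
      rcases mem_union.1 h with h | h
      · exact haW h
      · rcases mem_insert.1 h with h | h
        · exact hab h
        · exact haπ (mem_singleton.1 h)
    · intro h
      rcases mem_union.1 h with h | h
      · exact hπaW h
      · rcases mem_insert.1 h with h | h
        · exact haπ ((π_eq_iff hπ).1 h)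
        · exact hab (π_injective hπ (mem_singleton.1 h))
    · rw [card_inter_union_pair hbW hπbW, hX]; ring
  · intro U hU
    simp only [mem_coe, mem_filter] at hU
    obtain ⟨_, hbf, _, _⟩ := hU
    obtain ⟨hbU, hπbU⟩ := mem_full.1 hbf
    show (U \ {b, π b}) ∪ {b, π b} = U
    exact sdiff_union_of_subset (hPsub hbU hπbU)
  · intro W hW
    simp only [mem_coe, mem_filter] at hW
    obtain ⟨hWsh, _⟩ := hW
    have hWS := (mem_shellIn.1 hWsh).1
    have hbW : b ∉ W := fun h => (mem_del2.1 (hWS h)).2.1 rfl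
    have hπbW : π b ∉ W := fun h => (mem_del2.1 (hWS h)).2.2.1 rfl
    have hdisj : Disjoint W {b, π b} := disjoint_left.2 fun v hvW hvP => by
      rcases mem_insert.1 hvP with rfl | h
      · exact hbW hvW
      · rw [mem_singleton] at h; subst h; exact hπbW hvW
    show (W ∪ {b, π b}) \ {b, π b} = W
    rw [union_sdiff_right, sdiff_eq_self_of_disjoint hdisj]

omit hπ hπ' in
/-- A partner cannot be pinned free next to a full vertex: `pinned(b, π b) = 0`.
[cite: Rothvoss2017, §2 (PDF p. 5)] -/
theorem pinned_partner_eq_zero (S H : Finset (Fin n)) (T c : ℕ) (b : Fin n) (x : ℤ) :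
    pinned π S H T c b (π b) x = 0 := by
  rw [pinned]
  norm_cast
  rw [card_eq_zero, filter_eq_empty_iff]
  intro U _ h
  exact (mem_freeIn.1 h.2.1).2.1 (mem_full.1 h.1).2

omit hπ hπ' in
/-- The flux `F₀₁` as a sum of pinned counts over `b ∈ S ∖ H`, `a ∈ S ∩ H`.
[cite: Rothvoss2017, §2 (PDF p. 6)] -/
theorem flux01_eq_sum_pinned (S H : Finset (Fin n)) (T c : ℕ) (x : ℤ) :
    flux01 π S H T c x = ∑ b ∈ S \ H, ∑ a ∈ S ∩ H, pinned π S H T c b a x := by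
  have step : ∀ U ∈ shellIn π S T c,
      (∑ _b ∈ full π U \ H, ∑ _a ∈ freeIn π S U ∩ H, if ((U ∩ H).card : ℤ) = x then (1 : ℝ) else 0) =
        ∑ b ∈ S \ H, ∑ a ∈ S ∩ H,
          if b ∈ full π U ∧ a ∈ freeIn π S U ∧ ((U ∩ H).card : ℤ) = x then (1 : ℝ) else 0 := by
    intro U hU
    have hUS := (mem_shellIn.1 hU).1
    have e1 : full π U \ H = (S \ H).filter fun b => b ∈ full π U := by
      ext b
      simp only [mem_sdiff, mem_filter, mem_full]
      constructor
      · rintro ⟨⟨hbU, hπb⟩, hbH⟩; exact ⟨⟨hUS hbU, hbH⟩, hbU, hπb⟩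
      · rintro ⟨⟨_, hbH⟩, hbU, hπb⟩; exact ⟨⟨hbU, hπb⟩, hbH⟩
    have e2 : freeIn π S U ∩ H = (S ∩ H).filter fun a => a ∈ freeIn π S U := by
      ext a
      simp only [mem_inter, mem_filter, mem_freeIn]
      tauto
    rw [e1, sum_filter]
    refine sum_congr rfl fun b _ => ?_
    by_cases hb : b ∈ full π U
    · rw [if_pos hb, e2, sum_filter]
      refine sum_congr rfl fun a _ => ?_
      by_cases ha : a ∈ freeIn π S U
      · rw [if_pos ha]; simp only [hb, ha, true_and]
      · rw [if_neg ha, if_neg fun h => ha h.2.1]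
    · rw [if_neg hb]
      exact (sum_eq_zero fun a _ => if_neg fun h => hb h.1).symm
  rw [flux01, sum_congr rfl step, sum_comm]
  refine sum_congr rfl fun b _ => ?_
  rw [sum_comm]
  refine sum_congr rfl fun a _ => ?_
  rw [pinned, card_filter]
  push_cast
  rfl

omit hπ hπ' in
/-- The flux `F₁₀` as a sum of pinned counts over `b ∈ S ∩ H`, `a ∈ S ∖ H`.
[cite: Rothvoss2017, §2 (PDF p. 6)] -/
theorem flux10_eq_sum_pinned (S H : Finset (Fin n)) (T c : ℕ) (x : ℤ) :
    flux10 π S H T c x = ∑ b ∈ S ∩ H, ∑ a ∈ S \ H, pinned π S H T c b a x := by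
  have step : ∀ U ∈ shellIn π S T c,
      (∑ _b ∈ full π U ∩ H, ∑ _a ∈ freeIn π S U \ H, if ((U ∩ H).card : ℤ) = x then (1 : ℝ) else 0) =
        ∑ b ∈ S ∩ H, ∑ a ∈ S \ H,
          if b ∈ full π U ∧ a ∈ freeIn π S U ∧ ((U ∩ H).card : ℤ) = x then (1 : ℝ) else 0 := by
    intro U hU
    have hUS := (mem_shellIn.1 hU).1
    have e1 : full π U ∩ H = (S ∩ H).filter fun b => b ∈ full π U := by
      ext b
      simp only [mem_inter, mem_filter, mem_full]
      constructor
      · rintro ⟨⟨hbU, hπb⟩, hbH⟩; exact ⟨⟨hUS hbU, hbH⟩, hbU, hπb⟩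
      · rintro ⟨⟨_, hbH⟩, hbU, hπb⟩; exact ⟨⟨hbU, hπb⟩, hbH⟩
    have e2 : freeIn π S U \ H = (S \ H).filter fun a => a ∈ freeIn π S U := by
      ext a
      simp only [mem_sdiff, mem_filter, mem_freeIn]
      tauto
    rw [e1, sum_filter]
    refine sum_congr rfl fun b _ => ?_
    by_cases hb : b ∈ full π U
    · rw [if_pos hb, e2, sum_filter]
      refine sum_congr rfl fun a _ => ?_
      by_cases ha : a ∈ freeIn π S U
      · rw [if_pos ha]; simp only [hb, ha, true_and]
      · rw [if_neg ha, if_neg fun h => ha h.2.1]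
    · rw [if_neg hb]
      exact (sum_eq_zero fun a _ => if_neg fun h => hb h.1).symm
  rw [flux10, sum_congr rfl step, sum_comm]
  refine sum_congr rfl fun b _ => ?_
  rw [sum_comm]
  refine sum_congr rfl fun a _ => ?_
  rw [pinned, card_filter]
  push_cast
  rfl

omit hπ hπ' in
/-- `S ∖ H = BN ⊔ DD`, as a splitting of sums. [cite: Rothvoss2017, §2 (PDF p. 5)] -/
theorem sum_sdiff_block_eq (S H : Finset (Fin n)) (F : Fin n → ℝ) :
    ∑ v ∈ S \ H, F v = ∑ v ∈ vBN π S H, F v + ∑ v ∈ vDD π S H, F v := by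
  rw [← sum_filter_add_sum_filter_not (S \ H) (fun v => π v ∈ H)]
  congr 1
  · refine sum_congr ?_ fun _ _ => rfl
    ext v; simp only [mem_filter, mem_sdiff, mem_vBN]; tauto
  · refine sum_congr ?_ fun _ _ => rfl
    ext v; simp only [mem_filter, mem_sdiff, mem_vDD]; tauto

omit hπ hπ' in
/-- `S ∩ H = AA ⊔ BH`, as a splitting of sums. [cite: Rothvoss2017, §2 (PDF p. 5)] -/
theorem sum_inter_block_eq (S H : Finset (Fin n)) (F : Fin n → ℝ) :
    ∑ v ∈ S ∩ H, F v = ∑ v ∈ vAA π S H, F v + ∑ v ∈ vBH π S H, F v := by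
  rw [← sum_filter_add_sum_filter_not (S ∩ H) (fun v => π v ∈ H)]
  congr 1
  · refine sum_congr ?_ fun _ _ => rfl
    ext v; simp only [mem_filter, mem_inter, mem_vAA]; tauto
  · refine sum_congr ?_ fun _ _ => rfl
    ext v; simp only [mem_filter, mem_inter, mem_vBH]; tauto

omit hπ hπ' in
/-- `|{b, π b} ∩ H|` by the type of `b`: `DD ↦ 0`. [cite: Rothvoss2017, §2 (PDF p. 5)] -/
theorem card_pair_inter_DD {H : Finset (Fin n)} {b : Fin n} (hb : b ∉ H) (hπb : π b ∉ H) :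
    ((({b, π b} ∩ H).card : ℕ) : ℤ) = 0 := by
  rw [insert_inter_of_notMem hb, singleton_inter_of_notMem hπb, card_empty]; rfl

omit hπ hπ' in
/-- `BN ↦ 1`. [cite: Rothvoss2017, §2 (PDF p. 5)] -/
theorem card_pair_inter_BN {H : Finset (Fin n)} {b : Fin n} (hb : b ∉ H) (hπb : π b ∈ H) :
    ((({b, π b} ∩ H).card : ℕ) : ℤ) = 1 := by
  rw [insert_inter_of_notMem hb, singleton_inter_of_mem hπb, card_singleton]; rfl

omit hπ in
/-- `AA ↦ 2`. [cite: Rothvoss2017, §2 (PDF p. 5)] -/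
theorem card_pair_inter_AA {H : Finset (Fin n)} {b : Fin n} (hb : b ∈ H) (hπb : π b ∈ H) :
    ((({b, π b} ∩ H).card : ℕ) : ℤ) = 2 := by
  rw [insert_inter_of_mem hb, singleton_inter_of_mem hπb, card_pair (hπ' b).symm]; rfl

omit hπ hπ' in
/-- `BH ↦ 1`. [cite: Rothvoss2017, §2 (PDF p. 5)] -/
theorem card_pair_inter_BH {H : Finset (Fin n)} {b : Fin n} (hb : b ∈ H) (hπb : π b ∉ H) :
    ((({b, π b} ∩ H).card : ℕ) : ℤ) = 1 := by
  rw [insert_inter_of_mem hb, singleton_inter_of_notMem hπb, card_insert_of_notMem (notMem_empty _),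
    card_empty]; rfl

/-- **The flux `F₀₁` by deletions**:
`F₀₁(x) = Σ_{BN×AA} Sh′(x−1) + Σ_{BN×(BH∖π b)} Sh′(x−1) + Σ_{DD×AA} Sh′(x) + Σ_{DD×BH} Sh′(x)`
(`Sh′` = shell count of `S` with the two edges deleted, cut size `t`). [cite: Rothvoss2017, §2 (PDF p. 6)] -/
theorem flux01_eq_del {S : Finset (Fin n)} (hS : ∀ v ∈ S, π v ∈ S) (H : Finset (Fin n)) (t c : ℕ)
    (x : ℤ) :
    flux01 π S H (t + 2) c x =
      (∑ b ∈ vBN π S H, ∑ a ∈ vAA π S H, shellCount π (del2 π S b a) H t c (x - 1)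
        + ∑ b ∈ vBN π S H, ∑ a ∈ (vBH π S H).erase (π b), shellCount π (del2 π S b a) H t c (x - 1))
      + (∑ b ∈ vDD π S H, ∑ a ∈ vAA π S H, shellCount π (del2 π S b a) H t c x
        + ∑ b ∈ vDD π S H, ∑ a ∈ vBH π S H, shellCount π (del2 π S b a) H t c x) := by
  rw [flux01_eq_sum_pinned, sum_sdiff_block_eq]
  congr 1
  · rw [← sum_add_distrib]
    refine sum_congr rfl fun b hb => ?_
    obtain ⟨hbS, hbH, hπbH⟩ := mem_vBN.1 hb
    rw [sum_inter_block_eq]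
    congr 1
    · refine sum_congr rfl fun a ha => ?_
      obtain ⟨haS, haH, hπaH⟩ := mem_vAA.1 ha
      have hab : a ≠ b := fun e => hbH (e ▸ haH)
      have haπ : a ≠ π b := fun e => hbH (by rw [e, hπ] at hπaH; exact hπaH)
      rw [pinned_eq_shellCount hπ hπ' hS H hbS haS hab haπ, card_pair_inter_BN hbH hπbH]
    · rw [← sum_erase (vBH π S H) (pinned_partner_eq_zero S H (t + 2) c b x)]
      refine sum_congr rfl fun a ha => ?_
      obtain ⟨haπ, ha'⟩ := mem_erase.1 ha
      obtain ⟨haS, haH, _⟩ := mem_vBH.1 ha'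
      have hab : a ≠ b := fun e => hbH (e ▸ haH)
      rw [pinned_eq_shellCount hπ hπ' hS H hbS haS hab haπ, card_pair_inter_BN hbH hπbH]
  · rw [← sum_add_distrib]
    refine sum_congr rfl fun b hb => ?_
    obtain ⟨hbS, hbH, hπbH⟩ := mem_vDD.1 hb
    rw [sum_inter_block_eq]
    congr 1
    · refine sum_congr rfl fun a ha => ?_
      obtain ⟨haS, haH, _⟩ := mem_vAA.1 ha
      have hab : a ≠ b := fun e => hbH (e ▸ haH)
      have haπ : a ≠ π b := fun e => hπbH (e ▸ haH)
      rw [pinned_eq_shellCount hπ hπ' hS H hbS haS hab haπ, card_pair_inter_DD hbH hπbH, sub_zero]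
    · refine sum_congr rfl fun a ha => ?_
      obtain ⟨haS, haH, _⟩ := mem_vBH.1 ha
      have hab : a ≠ b := fun e => hbH (e ▸ haH)
      have haπ : a ≠ π b := fun e => hπbH (e ▸ haH)
      rw [pinned_eq_shellCount hπ hπ' hS H hbS haS hab haπ, card_pair_inter_DD hbH hπbH, sub_zero]

/-- **The flux `F₁₀` by deletions**:
`F₁₀(x+1) = Σ_{AA×BN} Sh′(x−1) + Σ_{AA×DD} Sh′(x−1) + Σ_{BH×(BN∖π b)} Sh′(x) + Σ_{BH×DD} Sh′(x)`.
[cite: Rothvoss2017, §2 (PDF p. 6)] -/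
theorem flux10_eq_del {S : Finset (Fin n)} (hS : ∀ v ∈ S, π v ∈ S) (H : Finset (Fin n)) (t c : ℕ)
    (x : ℤ) :
    flux10 π S H (t + 2) c (x + 1) =
      (∑ b ∈ vAA π S H, ∑ a ∈ vBN π S H, shellCount π (del2 π S b a) H t c (x - 1)
        + ∑ b ∈ vAA π S H, ∑ a ∈ vDD π S H, shellCount π (del2 π S b a) H t c (x - 1))
      + (∑ b ∈ vBH π S H, ∑ a ∈ (vBN π S H).erase (π b), shellCount π (del2 π S b a) H t c x
        + ∑ b ∈ vBH π S H, ∑ a ∈ vDD π S H, shellCount π (del2 π S b a) H t c x) := by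
  rw [flux10_eq_sum_pinned, sum_inter_block_eq]
  congr 1
  · rw [← sum_add_distrib]
    refine sum_congr rfl fun b hb => ?_
    obtain ⟨hbS, hbH, hπbH⟩ := mem_vAA.1 hb
    rw [sum_sdiff_block_eq]
    congr 1
    · refine sum_congr rfl fun a ha => ?_
      obtain ⟨haS, haH, _⟩ := mem_vBN.1 ha
      have hab : a ≠ b := fun e => haH (e ▸ hbH)
      have haπ : a ≠ π b := fun e => haH (e ▸ hπbH)
      rw [pinned_eq_shellCount hπ hπ' hS H hbS haS hab haπ, card_pair_inter_AA hπ' hbH hπbH]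
      ring_nf
    · refine sum_congr rfl fun a ha => ?_
      obtain ⟨haS, haH, _⟩ := mem_vDD.1 ha
      have hab : a ≠ b := fun e => haH (e ▸ hbH)
      have haπ : a ≠ π b := fun e => haH (e ▸ hπbH)
      rw [pinned_eq_shellCount hπ hπ' hS H hbS haS hab haπ, card_pair_inter_AA hπ' hbH hπbH]
      ring_nf
  · rw [← sum_add_distrib]
    refine sum_congr rfl fun b hb => ?_
    obtain ⟨hbS, hbH, hπbH⟩ := mem_vBH.1 hb
    rw [sum_sdiff_block_eq]
    congr 1
    · rw [← sum_erase (vBN π S H) (pinned_partner_eq_zero S H (t + 2) c b (x + 1))]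
      refine sum_congr rfl fun a ha => ?_
      obtain ⟨haπ, ha'⟩ := mem_erase.1 ha
      obtain ⟨haS, haH, _⟩ := mem_vBN.1 ha'
      have hab : a ≠ b := fun e => haH (e ▸ hbH)
      rw [pinned_eq_shellCount hπ hπ' hS H hbS haS hab haπ, card_pair_inter_BH hbH hπbH]
      ring_nf
    · refine sum_congr rfl fun a ha => ?_
      obtain ⟨haS, haH, hπaH⟩ := mem_vDD.1 ha
      have hab : a ≠ b := fun e => haH (e ▸ hbH)
      have haπ : a ≠ π b := fun e => hπaH (by rw [e, hπ]; exact hbH)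
      rw [pinned_eq_shellCount hπ hπ' hS H hbS haS hab haπ, card_pair_inter_BH hbH hπbH]
      ring_nf

omit hπ hπ' in
/-- Swapping the roles of the two deleted edges in a double deletion sum.
[cite: GodsilMeagher2015, §15.2] -/
theorem sum_del2_comm (S H A B : Finset (Fin n)) (t c : ℕ) (y : ℤ) :
    ∑ b ∈ A, ∑ a ∈ B, shellCount π (del2 π S b a) H t c y =
      ∑ a ∈ B, ∑ b ∈ A, shellCount π (del2 π S a b) H t c y := by
  rw [sum_comm]
  exact sum_congr rfl fun a _ => sum_congr rfl fun b _ => by rw [del2_comm]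

omit hπ' in
/-- The same for the off-partner mixed sum. [cite: GodsilMeagher2015, §15.2] -/
theorem sum_del2_comm_erase (S H : Finset (Fin n)) (t c : ℕ) (y : ℤ) :
    ∑ b ∈ vBN π S H, ∑ a ∈ (vBH π S H).erase (π b), shellCount π (del2 π S b a) H t c y =
      ∑ a ∈ vBH π S H, ∑ b ∈ (vBN π S H).erase (π a), shellCount π (del2 π S a b) H t c y := by
  rw [sum_comm' (s' := fun a => (vBN π S H).erase (π a)) (t' := vBH π S H)]
  · exact sum_congr rfl fun a _ => sum_congr rfl fun b _ => by rw [del2_comm]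
  · intro b a
    simp only [mem_erase]
    constructor
    · rintro ⟨hb, hab, ha⟩
      exact ⟨⟨fun e => hab ((π_eq_iff hπ).2 e).symm, hb⟩, ha⟩
    · rintro ⟨⟨hba, hb⟩, ha⟩
      exact ⟨hb, fun e => hba ((π_eq_iff hπ).2 e).symm, ha⟩

/-- **The flux balance**: `F₀₁(x) − F₁₀(x+1) = G(x) − G(x−1)` — the mixed type classes cancel, the
`AA × DD` deletions carry `+`, the ordered pairs of distinct mixed edges carry `−`.
[cite: Rothvoss2017, §2 (PDF p. 6)] -/
theorem flux01_sub_flux10 {S : Finset (Fin n)} (hS : ∀ v ∈ S, π v ∈ S) (H : Finset (Fin n))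
    (t c : ℕ) (x : ℤ) :
    flux01 π S H (t + 2) c x - flux10 π S H (t + 2) c (x + 1) =
      delStep π S H t c x - delStep π S H t c (x - 1) := by
  rw [flux01_eq_del hπ hπ' hS, flux10_eq_del hπ hπ' hS, delStep, delStep,
    sum_del2_comm S H (vBN π S H) (vAA π S H),
    sum_del2_comm S H (vDD π S H) (vAA π S H),
    sum_del2_comm S H (vDD π S H) (vBH π S H),
    sum_del2_comm_erase hπ S H t c (x - 1)]
  ring

/-! ### §5 The main theorem -/

/-- **One level step is one second difference** (exact): for every ground set `S` stable under the
fixed-point-free involution `π`, every block `H`, all `t, c` and all `x ∈ ℤ`,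
`(c+2)(c+1) · Sh_S(t+2, c+2; x) − (t+2−c)(|S|−t−2−c) · Sh_S(t+2, c; x) = −(G(x) − 2G(x−1) + G(x−2))`
with `G = delStep` the signed two-edge deletion sum. [cite: Rothvoss2017, §2 (PDF p. 6)] -/
theorem levelStep_shellCount {S : Finset (Fin n)} (hS : ∀ v ∈ S, π v ∈ S) (H : Finset (Fin n))
    (t c : ℕ) (x : ℤ) :
    ((c + 2) * (c + 1) : ℝ) * shellCount π S H (t + 2) (c + 2) x
        - ((t : ℝ) + 2 - c) * ((S.card : ℝ) - (t + 2) - c) * shellCount π S H (t + 2) c x =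
      -(delStep π S H t c x - 2 * delStep π S H t c (x - 1) + delStep π S H t c (x - 2)) := by
  have h := levelStep_eq_flux hπ hπ' hS H (t + 2) c x
  push_cast at h
  have h1 := flux01_sub_flux10 hπ hπ' hS H t c x
  have h2 := flux01_sub_flux10 hπ hπ' hS H t c (x - 1)
  rw [sub_add_cancel, show x - 1 - 1 = x - 2 by ring] at h2
  linarith


/-! ### §6 Iteration: `m` level steps are `m` second differences of the `m`-fold deletion sums -/

end Involution

section Operators

/-- A level profile: level `c ↦` (block count `x ↦` value). [cite: Rothvoss2017, §2 (PDF p. 6)] -/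
abbrev Profile : Type := ℕ → ℤ → ℝ

/-- The second `x`-difference `∇²P(c)(x) = P(c)(x) − 2P(c)(x−1) + P(c)(x−2)` of a profile.
[cite: Rothvoss2017, §2 (PDF p. 6)] -/
def nab2 (P : Profile) : Profile := fun c x => P c x - 2 * P c (x - 1) + P c (x - 2)

/-- The weighted level step with parameters `(A, B)` (think `A = |U|`, `B = |S|`):
`(L_{A,B} P)(c) = (c+2)(c+1)·P(c+2) − (A−c)(B−A−c)·P(c)`. [cite: Rothvoss2017, §2 (PDF p. 6)] -/
def lstep (A B : ℝ) (P : Profile) : Profile :=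
  fun c x => ((c : ℝ) + 2) * ((c : ℝ) + 1) * P (c + 2) x - (A - c) * (B - A - c) * P c x

/-- The `m`-fold weighted level step `L_{A−2(m−1),B−4(m−1)} ∘ ⋯ ∘ L_{A−2,B−4} ∘ L_{A,B}` (each deletion
lowers the cut size by `2` and the ground set by `4` vertices). [cite: Rothvoss2017, §2 (PDF p. 6)] -/
def liter : ℕ → ℝ → ℝ → Profile → Profile
  | 0, _, _, P => P
  | m + 1, A, B, P => liter m (A - 2) (B - 4) (lstep A B P)

/-- No level step. [cite: Rothvoss2017, §2 (PDF p. 6)] -/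
@[simp] theorem liter_zero (A B : ℝ) (P : Profile) : liter 0 A B P = P := rfl

/-- One more level step (innermost first). [cite: Rothvoss2017, §2 (PDF p. 6)] -/
@[simp] theorem liter_succ (m : ℕ) (A B : ℝ) (P : Profile) :
    liter (m + 1) A B P = liter m (A - 2) (B - 4) (lstep A B P) := rfl

/-- `L_{A,B}` is additive: differences. [cite: Rothvoss2017, §2 (PDF p. 6)] -/
theorem lstep_sub (A B : ℝ) (P Q : Profile) : lstep A B (P - Q) = lstep A B P - lstep A B Q := by
  funext c x; simp only [lstep, Pi.sub_apply]; ring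

/-- `L_{A,B}` is additive: sums. [cite: Rothvoss2017, §2 (PDF p. 6)] -/
theorem lstep_add (A B : ℝ) (P Q : Profile) : lstep A B (P + Q) = lstep A B P + lstep A B Q := by
  funext c x; simp only [lstep, Pi.add_apply]; ring

/-- `L_{A,B} 0 = 0`. [cite: Rothvoss2017, §2 (PDF p. 6)] -/
theorem lstep_zero (A B : ℝ) : lstep A B 0 = 0 := by
  funext c x; simp [lstep]

/-- `L_{A,B}` commutes with negation. [cite: Rothvoss2017, §2 (PDF p. 6)] -/
theorem lstep_neg (A B : ℝ) (P : Profile) : lstep A B (-P) = -lstep A B P := by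
  funext c x; simp only [lstep, Pi.neg_apply]; ring

/-- `L_{A,B}` is homogeneous. [cite: Rothvoss2017, §2 (PDF p. 6)] -/
theorem lstep_smul (A B r : ℝ) (P : Profile) : lstep A B (r • P) = r • lstep A B P := by
  funext c x; simp only [lstep, Pi.smul_apply, smul_eq_mul]; ring

/-- The level step commutes with the second `x`-difference. [cite: Rothvoss2017, §2 (PDF p. 6)] -/
theorem lstep_nab2 (A B : ℝ) (P : Profile) : lstep A B (nab2 P) = nab2 (lstep A B P) := by
  funext c x; simp only [lstep, nab2]; ring

/-- `∇²` is additive: differences. [cite: Rothvoss2017, §2 (PDF p. 6)] -/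
theorem nab2_sub (P Q : Profile) : nab2 (P - Q) = nab2 P - nab2 Q := by
  funext c x; simp only [nab2, Pi.sub_apply]; ring

/-- `∇²` is additive: sums. [cite: Rothvoss2017, §2 (PDF p. 6)] -/
theorem nab2_add (P Q : Profile) : nab2 (P + Q) = nab2 P + nab2 Q := by
  funext c x; simp only [nab2, Pi.add_apply]; ring

/-- `∇² 0 = 0`. [cite: Rothvoss2017, §2 (PDF p. 6)] -/
theorem nab2_zero : nab2 0 = 0 := by
  funext c x; simp [nab2]

/-- `∇²` commutes with negation. [cite: Rothvoss2017, §2 (PDF p. 6)] -/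
theorem nab2_neg (P : Profile) : nab2 (-P) = -nab2 P := by
  funext c x; simp only [nab2, Pi.neg_apply]; ring

/-- `∇²` is homogeneous. [cite: Rothvoss2017, §2 (PDF p. 6)] -/
theorem nab2_smul (r : ℝ) (P : Profile) : nab2 (r • P) = r • nab2 P := by
  funext c x; simp only [nab2, Pi.smul_apply, smul_eq_mul]; ring

/-- `∇²` of a finite sum of profiles. [cite: Rothvoss2017, §2 (PDF p. 6)] -/
theorem nab2_sum {ι : Type*} (s : Finset ι) (P : ι → Profile) :
    nab2 (∑ i ∈ s, P i) = ∑ i ∈ s, nab2 (P i) := by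
  classical
  induction s using Finset.induction_on with
  | empty => simp [nab2_zero]
  | insert a s ha ih => rw [sum_insert ha, sum_insert ha, nab2_add, ih]

/-- `(∇²)^m` of a difference. [cite: Rothvoss2017, §2 (PDF p. 6)] -/
theorem nab2_iterate_sub (m : ℕ) (P Q : Profile) :
    nab2^[m] (P - Q) = nab2^[m] P - nab2^[m] Q := by
  induction m generalizing P Q with
  | zero => rfl
  | succ m ih => simp only [Function.iterate_succ, Function.comp, nab2_sub, ih]

/-- `(∇²)^m` is homogeneous. [cite: Rothvoss2017, §2 (PDF p. 6)] -/
theorem nab2_iterate_smul (m : ℕ) (r : ℝ) (P : Profile) : nab2^[m] (r • P) = r • nab2^[m] P := by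
  induction m generalizing P with
  | zero => rfl
  | succ m ih => simp only [Function.iterate_succ, Function.comp, nab2_smul, ih]

/-- `(∇²)^m` of a finite sum of profiles. [cite: Rothvoss2017, §2 (PDF p. 6)] -/
theorem nab2_iterate_sum {ι : Type*} (m : ℕ) (s : Finset ι) (P : ι → Profile) :
    nab2^[m] (∑ i ∈ s, P i) = ∑ i ∈ s, nab2^[m] (P i) := by
  induction m generalizing P with
  | zero => rfl
  | succ m ih => simp only [Function.iterate_succ, Function.comp, nab2_sum, ih]

/-- The iterated level step of a difference. [cite: Rothvoss2017, §2 (PDF p. 6)] -/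
theorem liter_sub (m : ℕ) (A B : ℝ) (P Q : Profile) :
    liter m A B (P - Q) = liter m A B P - liter m A B Q := by
  induction m generalizing A B P Q with
  | zero => rfl
  | succ m ih => simp only [liter_succ, lstep_sub, ih]

/-- The iterated level step of a sum. [cite: Rothvoss2017, §2 (PDF p. 6)] -/
theorem liter_add (m : ℕ) (A B : ℝ) (P Q : Profile) :
    liter m A B (P + Q) = liter m A B P + liter m A B Q := by
  induction m generalizing A B P Q with
  | zero => rfl
  | succ m ih => simp only [liter_succ, lstep_add, ih]

/-- The iterated level step of the zero profile. [cite: Rothvoss2017, §2 (PDF p. 6)] -/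
theorem liter_zero_profile (m : ℕ) (A B : ℝ) : liter m A B 0 = 0 := by
  induction m generalizing A B with
  | zero => rfl
  | succ m ih => simp only [liter_succ, lstep_zero, ih]

/-- The iterated level step commutes with negation. [cite: Rothvoss2017, §2 (PDF p. 6)] -/
theorem liter_neg (m : ℕ) (A B : ℝ) (P : Profile) : liter m A B (-P) = -liter m A B P := by
  induction m generalizing A B P with
  | zero => rfl
  | succ m ih => simp only [liter_succ, lstep_neg, ih]

/-- The iterated level step is homogeneous. [cite: Rothvoss2017, §2 (PDF p. 6)] -/
theorem liter_smul (m : ℕ) (A B r : ℝ) (P : Profile) : liter m A B (r • P) = r • liter m A B P := by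
  induction m generalizing A B P with
  | zero => rfl
  | succ m ih => simp only [liter_succ, lstep_smul, ih]

/-- The iterated level step commutes with the second `x`-difference. [cite: Rothvoss2017, §2 (PDF p. 6)] -/
theorem liter_nab2 (m : ℕ) (A B : ℝ) (P : Profile) : liter m A B (nab2 P) = nab2 (liter m A B P) := by
  induction m generalizing A B P with
  | zero => rfl
  | succ m ih => simp only [liter_succ, lstep_nab2, ih]

/-- The iterated level step of a finite sum of profiles. [cite: Rothvoss2017, §2 (PDF p. 6)] -/
theorem liter_sum {ι : Type*} (m : ℕ) (A B : ℝ) (s : Finset ι) (P : ι → Profile) :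
    liter m A B (∑ i ∈ s, P i) = ∑ i ∈ s, liter m A B (P i) := by
  classical
  induction s using Finset.induction_on with
  | empty => simp [liter_zero_profile]
  | insert a s ha ih => rw [sum_insert ha, sum_insert ha, liter_add, ih]

end Operators

section Iterate

variable (π)

/-- The shell-law profile of `S` at cut size `T`: `c ↦ x ↦ Sh_S(T,c;x)`. [cite: Rothvoss2017, §2 (PDF p. 6)] -/
def prof (S H : Finset (Fin n)) (T : ℕ) : Profile := fun c x => shellCount π S H T c x

/-- The `m`-fold signed deletion profile at cut size `t`:
`D_0(S) = Sh_S(t,·;·)`, `D_{m+1}(S) = Σ_{v ∈ AA(S)} Σ_{w ∈ DD(S)} D_m(S∖{v,πv,w,πw}) −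
Σ_{v ∈ BH(S)} Σ_{w ∈ BN(S), w ≠ πv} D_m(S∖{v,πv,w,πw})` (so `D_1 = delStep`).
[cite: Rothvoss2017, §2 (PDF p. 6)] -/
def delIter (H : Finset (Fin n)) (t : ℕ) : ℕ → Finset (Fin n) → Profile
  | 0, S => prof π S H t
  | m + 1, S => (∑ v ∈ vAA π S H, ∑ w ∈ vDD π S H, delIter H t m (del2 π S v w))
      - ∑ v ∈ vBH π S H, ∑ w ∈ (vBN π S H).erase (π v), delIter H t m (del2 π S v w)

variable {π}

/-- `D_0(S)` is the shell-law profile itself. [cite: Rothvoss2017, §2 (PDF p. 6)] -/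
@[simp] theorem delIter_zero (H : Finset (Fin n)) (t : ℕ) (S : Finset (Fin n)) :
    delIter π H t 0 S = prof π S H t := rfl

/-- `D_{m+1}(S)` by one more two-edge deletion (outermost first). [cite: Rothvoss2017, §2 (PDF p. 6)] -/
@[simp] theorem delIter_succ (H : Finset (Fin n)) (t m : ℕ) (S : Finset (Fin n)) :
    delIter π H t (m + 1) S = (∑ v ∈ vAA π S H, ∑ w ∈ vDD π S H, delIter π H t m (del2 π S v w))
      - ∑ v ∈ vBH π S H, ∑ w ∈ (vBN π S H).erase (π v), delIter π H t m (del2 π S v w) := rfl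

/-- `D_1 = delStep`. [cite: Rothvoss2017, §2 (PDF p. 6)] -/
theorem delIter_one (H : Finset (Fin n)) (t : ℕ) (S : Finset (Fin n)) (c : ℕ) (x : ℤ) :
    delIter π H t 1 S c x = delStep π S H t c x := by
  simp [delIter, delStep, prof, Finset.sum_apply, Pi.sub_apply]

variable (hπ : ∀ v, π (π v) = v) (hπ' : ∀ v, π v ≠ v)
include hπ hπ'

omit hπ' in
/-- Deleting edges keeps the ground set stable under `π`. [cite: GodsilMeagher2015, §15.2] -/
theorem del2_stable {S : Finset (Fin n)} (hS : ∀ v ∈ S, π v ∈ S) (v w : Fin n) :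
    ∀ u ∈ del2 π S v w, π u ∈ del2 π S v w := by
  intro u hu
  obtain ⟨huS, huv, huπv, huw, huπw⟩ := mem_del2.1 hu
  refine mem_del2.2 ⟨hS u huS, fun e => huπv ((π_eq_iff hπ).1 e), fun e => huv (π_injective hπ e),
    fun e => huπw ((π_eq_iff hπ).1 e), fun e => huw (π_injective hπ e)⟩

/-- Deleting two different edges removes four vertices. [cite: GodsilMeagher2015, §15.2] -/
theorem card_del2 {S : Finset (Fin n)} (hS : ∀ v ∈ S, π v ∈ S) {v w : Fin n} (hv : v ∈ S)
    (hw : w ∈ S) (hwv : w ≠ v) (hwπv : w ≠ π v) : ((del2 π S v w).card : ℝ) = (S.card : ℝ) - 4 := by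
  have hsub : ({v, π v, w, π w} : Finset (Fin n)) ⊆ S := by
    intro u hu
    simp only [mem_insert, mem_singleton] at hu
    rcases hu with rfl | rfl | rfl | rfl
    · exact hv
    · exact hS _ hv
    · exact hw
    · exact hS _ hw
  have hπwv : π w ≠ v := fun e => hwπv ((π_eq_iff hπ).1 e)
  have hπwπv : π w ≠ π v := fun e => hwv (π_injective hπ e)
  have h4 : ({v, π v, w, π w} : Finset (Fin n)).card = 4 := by
    have h1 : v ∉ ({π v, w, π w} : Finset (Fin n)) := by
      simp only [mem_insert, mem_singleton, not_or]; exact ⟨(hπ' v).symm, hwv.symm, hπwv.symm⟩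
    have h2 : π v ∉ ({w, π w} : Finset (Fin n)) := by
      simp only [mem_insert, mem_singleton, not_or]; exact ⟨hwπv.symm, hπwπv.symm⟩
    rw [card_insert_of_notMem h1, card_insert_of_notMem h2, card_pair (hπ' w).symm]
  have hle : 4 ≤ S.card := h4 ▸ card_le_card hsub
  rw [del2, card_sdiff_of_subset hsub, h4, Nat.cast_sub hle]
  norm_num

/-- The four vertices removed for an `AA × DD` pair. [cite: GodsilMeagher2015, §15.2] -/
theorem card_del2_AD {S H : Finset (Fin n)} (hS : ∀ v ∈ S, π v ∈ S) {v w : Fin n}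
    (hv : v ∈ vAA π S H) (hw : w ∈ vDD π S H) : ((del2 π S v w).card : ℝ) = (S.card : ℝ) - 4 := by
  obtain ⟨hvS, hvH, hπvH⟩ := mem_vAA.1 hv
  obtain ⟨hwS, hwH, _⟩ := mem_vDD.1 hw
  exact card_del2 hπ hπ' hS hvS hwS (fun e => hwH (e ▸ hvH)) (fun e => hwH (e ▸ hπvH))

/-- The four vertices removed for an off-partner `BH × BN` pair. [cite: GodsilMeagher2015, §15.2] -/
theorem card_del2_BB {S H : Finset (Fin n)} (hS : ∀ v ∈ S, π v ∈ S) {v w : Fin n}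
    (hv : v ∈ vBH π S H) (hw : w ∈ (vBN π S H).erase (π v)) :
    ((del2 π S v w).card : ℝ) = (S.card : ℝ) - 4 := by
  obtain ⟨hvS, hvH, _⟩ := mem_vBH.1 hv
  obtain ⟨hwπv, hw'⟩ := mem_erase.1 hw
  obtain ⟨hwS, hwH, _⟩ := mem_vBN.1 hw'
  exact card_del2 hπ hπ' hS hvS hwS (fun e => hwH (e ▸ hvH)) hwπv

/-- The one-step identity in profile form: `L_{t+2,|S|} Sh_S(t+2,·;·) = −∇² D_1(S)`.
[cite: Rothvoss2017, §2 (PDF p. 6)] -/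
theorem lstep_prof {S : Finset (Fin n)} (hS : ∀ v ∈ S, π v ∈ S) (H : Finset (Fin n)) (t : ℕ) :
    lstep ((t : ℝ) + 2) (S.card : ℝ) (prof π S H (t + 2)) = -nab2 (delIter π H t 1 S) := by
  funext c x
  have h := levelStep_shellCount hπ hπ' hS H t c x
  simp only [lstep, prof, nab2, Pi.neg_apply, delIter_one]
  linarith

/-- **`m` LEVEL STEPS ARE `m` SECOND DIFFERENCES** (the iterated identity): for every `m`, every
`π`-stable ground set `S`, all `t, c, x`,
`(L_{t+2,|S|−4(m−1)} ∘ ⋯ ∘ L_{t+2m,|S|}) [c ↦ Sh_S(t+2m,c;·)] (c)(x) = (−1)^m (∇²)^m [D_m(S)(t,c;·)](x)`,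
with `D_m` the `m`-fold signed deletion profile (`delIter`): the weighted `m`-th level difference of the
shell law at cut size `t + 2m` is the `2m`-th `x`-difference of a signed sum, over sequences of `m`
two-edge deletions, of shell laws at cut size `t` of the sub-matchings with `2m` edges deleted. (For
the probability laws: `Δ^m_{(2)} law_c = ((−1)^m/(4^m (N)_{2m})) (∇²)^m[signed deletion sum of laws]`,
`N = |S|/2`.) [cite: Rothvoss2017, §2 (PDF p. 6)] -/
theorem liter_prof_eq {H : Finset (Fin n)} (t m : ℕ) :
    ∀ {S : Finset (Fin n)}, (∀ v ∈ S, π v ∈ S) →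
      liter m ((t : ℝ) + 2 * m) (S.card : ℝ) (prof π S H (t + 2 * m)) =
        ((-1 : ℝ) ^ m) • nab2^[m] (delIter π H t m S) := by
  induction m with
  | zero => intro S _; simp
  | succ m ih =>
    intro S hS
    rw [liter_succ]
    have e1 : ((t : ℝ) + 2 * (m + 1 : ℕ)) = ((t + 2 * m : ℕ) : ℝ) + 2 := by push_cast; ring
    have e2 : t + 2 * (m + 1) = (t + 2 * m) + 2 := by ring
    rw [e1, e2, lstep_prof hπ hπ' hS H (t + 2 * m)]
    have e3 : ((t + 2 * m : ℕ) : ℝ) + 2 - 2 = ((t : ℝ) + 2 * m) := by push_cast; ring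
    rw [e3, liter_neg, liter_nab2, delIter_succ, liter_sub, liter_sum, liter_sum]
    -- rewrite `|S| - 4` as the size of each deleted ground set and apply the induction hypothesis
    have hAD : ∑ v ∈ vAA π S H, liter m ((t : ℝ) + 2 * m) ((S.card : ℝ) - 4)
          (∑ w ∈ vDD π S H, delIter π H (t + 2 * m) 0 (del2 π S v w)) =
        ∑ v ∈ vAA π S H, ∑ w ∈ vDD π S H, ((-1 : ℝ) ^ m) • nab2^[m] (delIter π H t m (del2 π S v w)) := by
      refine sum_congr rfl fun v hv => ?_
      rw [liter_sum]
      refine sum_congr rfl fun w hw => ?_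
      rw [delIter_zero, ← card_del2_AD hπ hπ' hS hv hw]
      exact ih (del2_stable hπ hS v w)
    have hBB : ∑ v ∈ vBH π S H, liter m ((t : ℝ) + 2 * m) ((S.card : ℝ) - 4)
          (∑ w ∈ (vBN π S H).erase (π v), delIter π H (t + 2 * m) 0 (del2 π S v w)) =
        ∑ v ∈ vBH π S H, ∑ w ∈ (vBN π S H).erase (π v),
          ((-1 : ℝ) ^ m) • nab2^[m] (delIter π H t m (del2 π S v w)) := by
      refine sum_congr rfl fun v hv => ?_
      rw [liter_sum]
      refine sum_congr rfl fun w hw => ?_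
      rw [delIter_zero, ← card_del2_BB hπ hπ' hS hv hw]
      exact ih (del2_stable hπ hS v w)
    rw [hAD, hBB]
    -- collect: −∇²[Σ (−1)^m ∇^{2m} D − Σ (−1)^m ∇^{2m} D] = (−1)^{m+1} ∇^{2m+2}[Σ D − Σ D]
    simp only [delIter_succ, Function.iterate_succ_apply', nab2_iterate_sub, nab2_iterate_sum,
      ← Finset.smul_sum]
    rw [← smul_sub, nab2_smul, pow_succ, mul_smul, neg_one_smul, smul_neg]

end Iterate

/-! ### §7 Shell sizes depend only on `(|S|, t, c)`; the one- and two-edge pinning ratios; the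
normalised (probability-law) form of the level step -/

section Sizes

variable (hπ : ∀ v, π (π v) = v) (hπ' : ∀ v, π v ≠ v)
include hπ hπ'

omit hπ' in
/-- Deleting one edge keeps the ground set stable under `π`. [cite: GodsilMeagher2015, §15.2] -/
theorem sdiff_pair_stable {S : Finset (Fin n)} (hS : ∀ v ∈ S, π v ∈ S) (v : Fin n) :
    ∀ u ∈ S \ {v, π v}, π u ∈ S \ {v, π v} := by
  intro u hu
  rw [mem_sdiff, mem_insert, mem_singleton, not_or] at hu ⊢
  exact ⟨hS u hu.1, fun e => hu.2.2 ((π_eq_iff hπ).1 e), fun e => hu.2.1 (π_injective hπ e)⟩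

omit hπ in
/-- `|S ∖ e| = |S| − 2` for an edge `e = {v, π v} ⊆ S`. [cite: GodsilMeagher2015, §15.2] -/
theorem card_sdiff_pair {S : Finset (Fin n)} (hS : ∀ v ∈ S, π v ∈ S) {v : Fin n} (hv : v ∈ S) :
    (S \ {v, π v}).card + 2 = S.card := by
  have hsub : ({v, π v} : Finset (Fin n)) ⊆ S := by
    intro u hu
    rcases mem_insert.1 hu with rfl | h
    · exact hv
    · rw [mem_singleton] at h; subst h; exact hS _ hv
  rw [card_sdiff_of_subset hsub, card_pair (hπ' v).symm]
  have := card_le_card hsub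
  rw [card_pair (hπ' v).symm] at this
  omega

omit hπ hπ' in
/-- Cuts avoiding the edge at `v`: `#{U ∈ Shell_S(t,c) : v, πv ∉ U} = |Shell_{S∖e}(t,c)|`.
[cite: Rothvoss2017, §2 (PDF p. 6)] -/
theorem card_shellIn_avoid {S : Finset (Fin n)} (v : Fin n) (t c : ℕ) :
    ((shellIn π S t c).filter fun U => v ∉ U ∧ π v ∉ U).card = (shellIn π (S \ {v, π v}) t c).card := by
  congr 1
  ext U
  simp only [mem_filter, mem_shellIn, subset_sdiff, disjoint_insert_right, disjoint_singleton_right]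
  tauto

/-- Cuts through `v` but not `π v`: `#{U ∈ Shell_S(t+1,c+1) : v ∈ U, πv ∉ U} = |Shell_{S∖e}(t,c)|`
(`U = W ∪ {v}`, `v` is half-matched). [cite: Rothvoss2017, §2 (PDF p. 6)] -/
theorem card_shellIn_half {S : Finset (Fin n)} {v : Fin n} (hv : v ∈ S) (t c : ℕ) :
    ((shellIn π S (t + 1) (c + 1)).filter fun U => v ∈ U ∧ π v ∉ U).card =
      (shellIn π (S \ {v, π v}) t c).card := by
  have hvπ : v ≠ π v := (hπ' v).symm
  -- `half (insert v W) = insert v (half W)` for `W` avoiding the edge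
  have hhalf : ∀ W : Finset (Fin n), v ∉ W → π v ∉ W →
      half π (insert v W) = insert v (half π W) := by
    intro W hvW hπvW
    ext u
    simp only [mem_half, mem_insert]
    constructor
    · rintro ⟨rfl | huW, hπu⟩
      · exact Or.inl rfl
      · exact Or.inr ⟨huW, fun h => hπu (Or.inr h)⟩
    · rintro (rfl | ⟨huW, hπuW⟩)
      · exact ⟨Or.inl rfl, fun h => h.elim (fun e => hvπ e.symm) hπvW⟩
      · refine ⟨Or.inr huW, fun h => h.elim (fun e => ?_) hπuW⟩
        -- `π u = v` ⇒ `u = π v ∉ W`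
        exact hπvW (((π_eq_iff hπ).1 e) ▸ huW)
  refine card_nbij' (fun U => U.erase v) (fun W => insert v W) ?_ ?_ ?_ ?_
  · intro U hU
    simp only [mem_coe, mem_filter, mem_shellIn] at hU ⊢
    obtain ⟨⟨hUS, hUt, hUc⟩, hvU, hπvU⟩ := hU
    have hW : v ∉ U.erase v := fun h => (mem_erase.1 h).1 rfl
    have hπW : π v ∉ U.erase v := fun h => hπvU (mem_of_mem_erase h)
    have hUeq : U = insert v (U.erase v) := (insert_erase hvU).symm
    refine ⟨?_, ?_, ?_⟩
    · intro u hu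
      rw [mem_sdiff, mem_insert, mem_singleton, not_or]
      obtain ⟨huv, huU⟩ := mem_erase.1 hu
      exact ⟨hUS huU, huv, fun e => hπvU (e ▸ huU)⟩
    · rw [card_erase_of_mem hvU, hUt]; rfl
    · have h := hhalf (U.erase v) hW hπW
      rw [← hUeq] at h
      rw [h, card_insert_of_notMem (fun h' => hW (half_subset (π := π) _ h'))] at hUc
      omega
  · intro W hW
    simp only [mem_coe, mem_filter, mem_shellIn] at hW ⊢
    obtain ⟨hWS, hWt, hWc⟩ := hW
    have hvW : v ∉ W := fun h => by
      have := mem_sdiff.1 (hWS h); simp at this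
    have hπvW : π v ∉ W := fun h => by
      have := mem_sdiff.1 (hWS h); simp at this
    refine ⟨⟨?_, ?_, ?_⟩, mem_insert_self _ _, ?_⟩
    · intro u hu
      rcases mem_insert.1 hu with rfl | huW
      · exact hv
      · exact (mem_sdiff.1 (hWS huW)).1
    · rw [card_insert_of_notMem hvW, hWt]
    · rw [hhalf W hvW hπvW, card_insert_of_notMem (fun h' => hvW (half_subset (π := π) _ h')), hWc]
    · rw [mem_insert, not_or]; exact ⟨hvπ.symm, hπvW⟩
  · intro U hU
    simp only [mem_coe, mem_filter] at hU
    exact insert_erase hU.2.1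
  · intro W hW
    simp only [mem_coe, mem_shellIn] at hW
    have hvW : v ∉ W := fun h => by
      have := mem_sdiff.1 (hW.1 h); simp at this
    exact erase_insert hvW

/-- Cuts containing the edge at `v`: `#{U ∈ Shell_S(t+2,c) : v, πv ∈ U} = |Shell_{S∖e}(t,c)|`
(`U = W ∪ e`, the edge is full). [cite: Rothvoss2017, §2 (PDF p. 6)] -/
theorem card_shellIn_full {S : Finset (Fin n)} (hS : ∀ v ∈ S, π v ∈ S) {v : Fin n} (hv : v ∈ S)
    (t c : ℕ) :
    ((shellIn π S (t + 2) c).filter fun U => v ∈ U ∧ π v ∈ U).card =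
      (shellIn π (S \ {v, π v}) t c).card := by
  have hPcard : ({v, π v} : Finset (Fin n)).card = 2 := card_pair (hπ' v).symm
  have hPsub : ∀ {U : Finset (Fin n)}, v ∈ U → π v ∈ U → ({v, π v} : Finset (Fin n)) ⊆ U :=
    fun hvU hπvU u hu => by
      rcases mem_insert.1 hu with rfl | h
      · exact hvU
      · rw [mem_singleton] at h; subst h; exact hπvU
  refine card_nbij' (fun U => U \ {v, π v}) (fun W => W ∪ {v, π v}) ?_ ?_ ?_ ?_
  · intro U hU
    simp only [mem_coe, mem_filter, mem_shellIn] at hU ⊢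
    obtain ⟨⟨hUS, hUt, hUc⟩, hvU, hπvU⟩ := hU
    refine ⟨sdiff_subset_sdiff hUS le_rfl, ?_, ?_⟩
    · rw [card_sdiff_of_subset (hPsub hvU hπvU), hUt, hPcard]; rfl
    · rw [half_sdiff_pair hπ hvU hπvU, hUc]
  · intro W hW
    simp only [mem_coe, mem_filter, mem_shellIn] at hW ⊢
    obtain ⟨hWS, hWt, hWc⟩ := hW
    have hvW : v ∉ W := fun h => by
      have := mem_sdiff.1 (hWS h); simp at this
    have hπvW : π v ∉ W := fun h => by
      have := mem_sdiff.1 (hWS h); simp at this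
    have hdisj : Disjoint W {v, π v} := disjoint_left.2 fun u huW huP => by
      rcases mem_insert.1 huP with rfl | h
      · exact hvW huW
      · rw [mem_singleton] at h; subst h; exact hπvW huW
    have hvU : v ∈ W ∪ {v, π v} := mem_union_right _ (mem_insert_self _ _)
    have hπvU : π v ∈ W ∪ {v, π v} := mem_union_right _ (mem_insert_of_mem (mem_singleton_self _))
    refine ⟨⟨?_, ?_, ?_⟩, hvU, hπvU⟩
    · intro u hu
      rcases mem_union.1 hu with h | h
      · exact (mem_sdiff.1 (hWS h)).1
      · rcases mem_insert.1 h with rfl | h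
        · exact hv
        · rw [mem_singleton] at h; subst h; exact hS _ hv
    · rw [card_union_of_disjoint hdisj, hWt, hPcard]
    · have e : (W ∪ {v, π v}) \ {v, π v} = W := by
        rw [union_sdiff_right, sdiff_eq_self_of_disjoint hdisj]
      rw [← half_sdiff_pair hπ hvU hπvU, e, hWc]
  · intro U hU
    simp only [mem_coe, mem_filter] at hU
    exact sdiff_union_of_subset (hPsub hU.2.1 hU.2.2)
  · intro W hW
    simp only [mem_coe, mem_shellIn] at hW
    have hvW : v ∉ W := fun h => by
      have := mem_sdiff.1 (hW.1 h); simp at this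
    have hπvW : π v ∉ W := fun h => by
      have := mem_sdiff.1 (hW.1 h); simp at this
    have hdisj : Disjoint W {v, π v} := disjoint_left.2 fun u huW huP => by
      rcases mem_insert.1 huP with rfl | h
      · exact hvW huW
      · rw [mem_singleton] at h; subst h; exact hπvW huW
    show (W ∪ {v, π v}) \ {v, π v} = W
    rw [union_sdiff_right, sdiff_eq_self_of_disjoint hdisj]

omit hπ hπ' in
/-- A half-matched vertex forces `t, c ≥ 1`: `#{U ∈ Shell_S(t,c) : v ∈ U, πv ∉ U} = 0` if `t = 0` or
`c = 0`. [cite: Rothvoss2017, §2 (PDF p. 6)] -/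
theorem card_shellIn_half_eq_zero {S : Finset (Fin n)} (v : Fin n) {t c : ℕ} (h : t = 0 ∨ c = 0) :
    ((shellIn π S t c).filter fun U => v ∈ U ∧ π v ∉ U).card = 0 := by
  rw [card_eq_zero, filter_eq_empty_iff]
  rintro U hU ⟨hvU, hπvU⟩
  obtain ⟨_, hUt, hUc⟩ := mem_shellIn.1 hU
  have hvh : v ∈ half π U := mem_half.2 ⟨hvU, hπvU⟩
  rcases h with rfl | rfl
  · rw [card_eq_zero] at hUt; rw [hUt] at hvU; simp at hvU
  · rw [card_eq_zero] at hUc; rw [hUc] at hvh; simp at hvh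

omit hπ in
/-- A full edge forces `t ≥ 2`: `#{U ∈ Shell_S(t,c) : v, πv ∈ U} = 0` for `t ≤ 1`.
[cite: Rothvoss2017, §2 (PDF p. 6)] -/
theorem card_shellIn_full_eq_zero {S : Finset (Fin n)} (v : Fin n) {t c : ℕ} (h : t ≤ 1) :
    ((shellIn π S t c).filter fun U => v ∈ U ∧ π v ∈ U).card = 0 := by
  rw [card_eq_zero, filter_eq_empty_iff]
  rintro U hU ⟨hvU, hπvU⟩
  obtain ⟨_, hUt, _⟩ := mem_shellIn.1 hU
  have : ({v, π v} : Finset (Fin n)).card ≤ U.card := card_le_card fun u hu => by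
    rcases mem_insert.1 hu with rfl | h'
    · exact hvU
    · rw [mem_singleton] at h'; subst h'; exact hπvU
  rw [card_pair (hπ' v).symm, hUt] at this
  omega

omit hπ' in
/-- **The one-edge decomposition**: by the status of the edge at `v ∈ S` (untouched / `v` half /
`π v` half / full), `|Shell_S(t,c)| = #avoid + #half_v + #half_{πv} + #full`.
[cite: Rothvoss2017, §2 (PDF p. 6)] -/
theorem card_shellIn_decomp {S : Finset (Fin n)} (v : Fin n) (t c : ℕ) :
    (shellIn π S t c).card =
      ((shellIn π S t c).filter fun U => v ∉ U ∧ π v ∉ U).card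
      + ((shellIn π S t c).filter fun U => v ∈ U ∧ π v ∉ U).card
      + ((shellIn π S t c).filter fun U => π v ∈ U ∧ π (π v) ∉ U).card
      + ((shellIn π S t c).filter fun U => v ∈ U ∧ π v ∈ U).card := by
  rw [hπ]
  have h1 := card_filter_add_card_filter_not (s := shellIn π S t c) (fun U => v ∈ U)
  have h2 := card_filter_add_card_filter_not (s := (shellIn π S t c).filter fun U => v ∈ U)
    (fun U => π v ∈ U)
  have h3 := card_filter_add_card_filter_not (s := (shellIn π S t c).filter fun U => v ∉ U)
    (fun U => π v ∈ U)
  simp only [filter_filter] at h2 h3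
  have e3 : ((shellIn π S t c).filter fun U => v ∉ U ∧ π v ∈ U) =
      (shellIn π S t c).filter fun U => π v ∈ U ∧ v ∉ U := by
    congr 1; ext U; tauto
  rw [e3] at h3
  omega

/-- **Shell sizes depend only on the number of vertices**: for two `π`-stable ground sets of the same
size, `|Shell_{S₁}(t,c)| = |Shell_{S₂}(t,c)|` (induction on the one-edge decomposition; the common value
is `C(N,s)C(N−s,c)2^c`, `N = |S|/2`, `s = (t−c)/2`, not needed here). [cite: Rothvoss2017, §2 (PDF p. 6)] -/
theorem card_shellIn_eq_of_card_eq :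
    ∀ (k : ℕ) {S₁ S₂ : Finset (Fin n)}, S₁.card = k → S₂.card = k →
      (∀ v ∈ S₁, π v ∈ S₁) → (∀ v ∈ S₂, π v ∈ S₂) →
      ∀ t c, (shellIn π S₁ t c).card = (shellIn π S₂ t c).card := by
  intro k
  induction k using Nat.strong_induction_on with
  | _ k ih =>
    intro S₁ S₂ h1 h2 hS₁ hS₂ t c
    rcases S₁.eq_empty_or_nonempty with rfl | ⟨v, hv⟩
    · rw [card_empty] at h1
      have : S₂ = ∅ := card_eq_zero.1 (h2.trans h1.symm)
      subst this; rfl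
    · have hk : 2 ≤ k := by have := card_sdiff_pair hπ' hS₁ hv; omega
      have hne2 : S₂.Nonempty := by rw [← card_pos]; omega
      obtain ⟨w, hw⟩ := hne2
      have hc1 := card_sdiff_pair hπ' hS₁ hv
      have hc2 := card_sdiff_pair hπ' hS₂ hw
      have ih' : ∀ t c, (shellIn π (S₁ \ {v, π v}) t c).card = (shellIn π (S₂ \ {w, π w}) t c).card :=
        ih (k - 2) (by omega) (by omega) (by omega) (sdiff_pair_stable hπ hS₁ v) (sdiff_pair_stable hπ hS₂ w)
      rw [card_shellIn_decomp hπ v t c, card_shellIn_decomp hπ w t c, card_shellIn_avoid, card_shellIn_avoid,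
        ih' t c]
      -- the half terms
      have hhalf : ∀ (u : Fin n) (S : Finset (Fin n)), u ∈ S →
          ((shellIn π S t c).filter fun U => u ∈ U ∧ π u ∉ U).card =
            if 1 ≤ t ∧ 1 ≤ c then (shellIn π (S \ {u, π u}) (t - 1) (c - 1)).card else 0 := by
        intro u S hu
        split_ifs with h
        · obtain ⟨t', rfl⟩ : ∃ t', t = t' + 1 := ⟨t - 1, by omega⟩
          obtain ⟨c', rfl⟩ : ∃ c', c = c' + 1 := ⟨c - 1, by omega⟩
          rw [card_shellIn_half hπ hπ' hu]; rfl
        · exact card_shellIn_half_eq_zero u (by omega)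
      have hfull : ∀ (u : Fin n) (S : Finset (Fin n)), (∀ x ∈ S, π x ∈ S) → u ∈ S →
          ((shellIn π S t c).filter fun U => u ∈ U ∧ π u ∈ U).card =
            if 2 ≤ t then (shellIn π (S \ {u, π u}) (t - 2) c).card else 0 := by
        intro u S hS hu
        split_ifs with h
        · obtain ⟨t', rfl⟩ : ∃ t', t = t' + 2 := ⟨t - 2, by omega⟩
          rw [card_shellIn_full hπ hπ' hS hu]; rfl
        · exact card_shellIn_full_eq_zero hπ' u (by omega)
      have hπv : π v ∈ S₁ := hS₁ v hv
      have hπw : π w ∈ S₂ := hS₂ w hw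
      rw [hhalf v S₁ hv, hhalf w S₂ hw, hhalf (π v) S₁ hπv, hhalf (π w) S₂ hπw, hfull v S₁ hS₁ hv,
        hfull w S₂ hS₂ hw]
      have epair1 : ({π v, π (π v)} : Finset (Fin n)) = {v, π v} := by rw [hπ, pair_comm]
      have epair2 : ({π w, π (π w)} : Finset (Fin n)) = {w, π w} := by rw [hπ, pair_comm]
      rw [epair1, epair2]
      split_ifs <;> simp [ih']


omit hπ hπ' in
/-- With `H = ∅` the shell count at `x = 0` is the shell size. [cite: Rothvoss2017, §2 (PDF p. 6)] -/
theorem shellCount_empty_zero (S : Finset (Fin n)) (t c : ℕ) :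
    shellCount π S ∅ t c 0 = ((shellIn π S t c).card : ℝ) := by
  rw [shellCount]
  congr 2
  exact filter_true_of_mem fun U _ => by simp

omit hπ hπ' in
/-- `del2` as two successive edge deletions. [cite: GodsilMeagher2015, §15.2] -/
theorem del2_eq_sdiff_sdiff (S : Finset (Fin n)) (v w : Fin n) :
    del2 π S v w = (S \ {v, π v}) \ {w, π w} := by
  ext u; simp only [mem_del2, mem_sdiff, mem_insert, mem_singleton, not_or]; tauto

/-- `|S ∖ e_v ∖ e_w| + 4 = |S|` for two different edges. [cite: GodsilMeagher2015, §15.2] -/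
theorem card_del2_add_four {S : Finset (Fin n)} (hS : ∀ v ∈ S, π v ∈ S) {v w : Fin n} (hv : v ∈ S)
    (hw : w ∈ S) (hwv : w ≠ v) (hwπv : w ≠ π v) : (del2 π S v w).card + 4 = S.card := by
  rw [del2_eq_sdiff_sdiff]
  have h1 := card_sdiff_pair hπ' hS hv
  have hw' : w ∈ S \ {v, π v} := by
    rw [mem_sdiff, mem_insert, mem_singleton, not_or]; exact ⟨hw, hwv, hwπv⟩
  have h2 := card_sdiff_pair hπ' (sdiff_pair_stable hπ hS v) hw'
  omega

/-- **The two-edge pinning ratio**: for every pair of distinct edges (`b`, `a ∉ {b, π b}` in `S`),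
`|S|(|S|−2) · |Shell_{S∖e_b∖e_a}(t,c)| = (t+2−c)(|S|−t−2−c) · |Shell_S(t+2,c)|`
(double count of (cut, full vertex, free vertex) + the pin bijection + size invariance).
[cite: Rothvoss2017, §2 (PDF p. 6)] -/
theorem card_shellIn_del2_ratio {S : Finset (Fin n)} (hS : ∀ v ∈ S, π v ∈ S) {b a : Fin n}
    (hb : b ∈ S) (ha : a ∈ S) (hab : a ≠ b) (haπ : a ≠ π b) (t c : ℕ) :
    (S.card : ℝ) * ((S.card : ℝ) - 2) * (shellIn π (del2 π S b a) t c).card =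
      ((t : ℝ) + 2 - c) * ((S.card : ℝ) - (t + 2) - c) * (shellIn π S (t + 2) c).card := by
  set T := shellIn π S (t + 2) c with hT
  set F : ℝ := ((shellIn π (del2 π S b a) t c).card : ℝ) with hF
  -- (2)+(3): every pinned count equals `F`
  have hpin : ∀ b' ∈ S, ∀ a' ∈ S \ {b', π b'}, pinned π S ∅ (t + 2) c b' a' 0 = F := by
    intro b' hb' a' ha'
    rw [mem_sdiff, mem_insert, mem_singleton, not_or] at ha'
    obtain ⟨ha'S, ha'b, ha'π⟩ := ha'
    rw [pinned_eq_shellCount hπ hπ' hS ∅ hb' ha'S ha'b ha'π, inter_empty, card_empty, Nat.cast_zero,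
      sub_zero, shellCount_empty_zero, hF]
    norm_cast
    refine card_shellIn_eq_of_card_eq hπ hπ' (S.card - 4) ?_ ?_ (del2_stable hπ hS b' a')
      (del2_stable hπ hS b a) t c
    · have := card_del2_add_four hπ hπ' hS hb' ha'S ha'b ha'π; omega
    · have := card_del2_add_four hπ hπ' hS hb ha hab haπ; omega
  -- (4): the number of pairs
  have hpairs : ∑ b' ∈ S, ∑ a' ∈ S \ {b', π b'}, pinned π S ∅ (t + 2) c b' a' 0 =
      (S.card : ℝ) * ((S.card : ℝ) - 2) * F := by
    rw [sum_congr rfl fun b' hb' => sum_congr rfl fun a' ha' => hpin b' hb' a' ha']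
    simp only [sum_const, nsmul_eq_mul]
    rw [sum_congr rfl fun b' hb' => by
      rw [show ((S \ {b', π b'}).card : ℝ) = (S.card : ℝ) - 2 by
        have := card_sdiff_pair hπ' hS hb'
        have h2 : 2 ≤ S.card := by omega
        rw [show (S \ {b', π b'}).card = S.card - 2 by omega, Nat.cast_sub h2]; norm_num]]
    rw [sum_const, nsmul_eq_mul]
    ring
  -- (1)+(5): double count
  have hcount : ∑ b' ∈ S, ∑ a' ∈ S \ {b', π b'}, pinned π S ∅ (t + 2) c b' a' 0 =
      ((t : ℝ) + 2 - c) * ((S.card : ℝ) - (t + 2) - c) * (T.card : ℝ) := by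
    have e1 : ∀ b' a' : Fin n, pinned π S ∅ (t + 2) c b' a' 0 =
        ∑ U ∈ T, if b' ∈ full π U ∧ a' ∈ freeIn π S U then (1 : ℝ) else 0 := by
      intro b' a'
      rw [pinned, card_filter]
      push_cast
      refine sum_congr rfl fun U _ => ?_
      simp
    simp_rw [e1]
    rw [sum_congr rfl fun b' _ => sum_comm, sum_comm]
    rw [show ((t : ℝ) + 2 - c) * ((S.card : ℝ) - (t + 2) - c) * (T.card : ℝ) =
        ∑ U ∈ T, ((t : ℝ) + 2 - c) * ((S.card : ℝ) - (t + 2) - c) by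
      rw [sum_const, nsmul_eq_mul]; ring]
    refine sum_congr rfl fun U hU => ?_
    have h3 := le_of_mem_shellIn hU
    have h4 := add_le_of_mem_shellIn hπ hS hU
    have hfree : ∀ b' ∈ full π U, ((S \ {b', π b'}).filter fun a' => a' ∈ freeIn π S U) = freeIn π S U := by
      intro b' hbf
      obtain ⟨hbU, hπbU⟩ := mem_full.1 hbf
      ext a'
      simp only [mem_filter, mem_sdiff, mem_insert, mem_singleton, not_or, mem_freeIn]
      constructor
      · rintro ⟨_, h⟩; exact h
      · rintro ⟨haS, haU, hπaU⟩
        exact ⟨⟨haS, fun e => haU (e ▸ hbU), fun e => haU (e ▸ hπbU)⟩, haS, haU, hπaU⟩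
    have e2 : ∀ b' ∈ S, (∑ a' ∈ S \ {b', π b'},
        if b' ∈ full π U ∧ a' ∈ freeIn π S U then (1 : ℝ) else 0) =
        if b' ∈ full π U then ((freeIn π S U).card : ℝ) else 0 := by
      intro b' _
      by_cases hbf : b' ∈ full π U
      · rw [if_pos hbf]
        conv_rhs => rw [← hfree b' hbf, card_filter, Nat.cast_sum]
        refine sum_congr rfl fun a' _ => ?_
        by_cases ha' : a' ∈ freeIn π S U <;> simp [hbf, ha']
      · rw [if_neg hbf]
        exact sum_eq_zero fun a' _ => if_neg fun h => hbf h.1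
    rw [sum_congr rfl e2, ← sum_filter, filter_mem_eq_inter,
      inter_eq_right.2 (fun b' hb' => (mem_shellIn.1 hU).1 (mem_full.1 hb').1), sum_const, nsmul_eq_mul,
      card_full_of_mem_shellIn hU, card_freeIn_of_mem_shellIn hπ hS hU, Nat.cast_sub h3,
      Nat.cast_sub (by omega), Nat.cast_sub (by omega)]
    push_cast
    ring
  rw [← hpairs, hcount]


/-- The shell LAW (probability) of the block statistic: `law_S(t,c;x) = Sh_S(t,c;x)/|Shell_S(t,c)|`
(zero for an empty shell). [cite: Rothvoss2017, §2 (PDF p. 6)] -/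
def shellLaw (π : Fin n → Fin n) (S H : Finset (Fin n)) (t c : ℕ) (x : ℤ) : ℝ :=
  shellCount π S H t c x / ((shellIn π S t c).card : ℝ)

/-- The signed deletion sum of LAWS: `Σ_{AA×DD} law_{S∖2e}(t,c;x) − Σ_{BH×BN, off-partner} law_{S∖2e}(t,c;x)`.
[cite: Rothvoss2017, §2 (PDF p. 6)] -/
def delStepLaw (π : Fin n → Fin n) (S H : Finset (Fin n)) (t c : ℕ) (x : ℤ) : ℝ :=
  (∑ v ∈ vAA π S H, ∑ w ∈ vDD π S H, shellLaw π (del2 π S v w) H t c x) -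
    ∑ v ∈ vBH π S H, ∑ w ∈ (vBN π S H).erase (π v), shellLaw π (del2 π S v w) H t c x

omit hπ hπ' in
/-- `Sh = |Shell| · law` (also for an empty shell). [cite: Rothvoss2017, §2 (PDF p. 6)] -/
theorem shellCount_eq_card_mul_shellLaw (S H : Finset (Fin n)) (t c : ℕ) (x : ℤ) :
    shellCount π S H t c x = ((shellIn π S t c).card : ℝ) * shellLaw π S H t c x := by
  rw [shellLaw]
  by_cases h0 : ((shellIn π S t c).card : ℝ) = 0
  · have hc : shellIn π S t c = ∅ := card_eq_zero.1 (by exact_mod_cast h0)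
    rw [shellCount, hc, filter_empty, card_empty, Nat.cast_zero, zero_div, mul_zero]
  · rw [mul_div_cancel₀ _ h0]

/-- **The level step for the probability laws** (the normalised form of `levelStep_shellCount`):
if `Shell_S(t+2,c+2) ≠ ∅`,
`law_S(t+2,c+2;x) − law_S(t+2,c;x) = −(1/(|S|(|S|−2))) · ∇²[ Σ_{AA×DD} law_{S∖2e}(t,c;·) − Σ_{BH×BN off-partner} law_{S∖2e}(t,c;·) ](x)`,
i.e. with `|S| = 2N` and the `H`-type `(a,b,d)`:
`law_{c+2} − law_c = −(1/(N(N−1)))·∇²[ a·d·avg_{AD} law′ − (b(b−1)/4)·avg_{BB} law″ ]`.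
[cite: Rothvoss2017, §2 (PDF p. 6)] -/
theorem levelStep_shellLaw {S : Finset (Fin n)} (hS : ∀ v ∈ S, π v ∈ S) (H : Finset (Fin n))
    (t c : ℕ) (hne : (shellIn π S (t + 2) (c + 2)).Nonempty) (x : ℤ) :
    shellLaw π S H (t + 2) (c + 2) x - shellLaw π S H (t + 2) c x =
      -(1 / ((S.card : ℝ) * ((S.card : ℝ) - 2))) *
        (delStepLaw π S H t c x - 2 * delStepLaw π S H t c (x - 1) + delStepLaw π S H t c (x - 2)) := by
  have hm4 : 4 ≤ S.card := by
    obtain ⟨U, hU⟩ := hne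
    have := add_le_of_mem_shellIn hπ hS hU
    omega
  have hm : (S.card : ℝ) * ((S.card : ℝ) - 2) ≠ 0 := by
    have h4 : (4 : ℝ) ≤ S.card := by exact_mod_cast hm4
    exact mul_ne_zero (by linarith) (by linarith)
  have hA : (0 : ℝ) < (shellIn π S (t + 2) (c + 2)).card := by exact_mod_cast hne.card_pos
  -- the common normaliser `K = (c+2)(c+1)|Shell_{c+2}| = (t+2−c)(|S|−t−2−c)|Shell_c|`
  have hKB : ((c : ℝ) + 2) * ((c : ℝ) + 1) * (shellIn π S (t + 2) (c + 2)).card =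
      ((t : ℝ) + 2 - c) * ((S.card : ℝ) - (t + 2) - c) * (shellIn π S (t + 2) c).card := by
    have h := shellStepIn_card hπ hπ' hS (t + 2) c
    push_cast at h
    linarith [h]
  have hKpos : 0 < ((c : ℝ) + 2) * ((c : ℝ) + 1) * (shellIn π S (t + 2) (c + 2)).card := by positivity
  -- every deleted shell has size `K / (|S|(|S|−2))`
  have hdel : ∀ y, delStep π S H t c y =
      (((c : ℝ) + 2) * ((c : ℝ) + 1) * (shellIn π S (t + 2) (c + 2)).card / ((S.card : ℝ) * ((S.card : ℝ) - 2)))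
        * delStepLaw π S H t c y := by
    intro y
    have hterm : ∀ v w : Fin n, v ∈ S → w ∈ S → w ≠ v → w ≠ π v →
        shellCount π (del2 π S v w) H t c y =
          (((c : ℝ) + 2) * ((c : ℝ) + 1) * (shellIn π S (t + 2) (c + 2)).card /
            ((S.card : ℝ) * ((S.card : ℝ) - 2))) * shellLaw π (del2 π S v w) H t c y := by
      intro v w hv hw hwv hwπ
      have hr := card_shellIn_del2_ratio hπ hπ' hS hv hw hwv hwπ t c
      rw [shellCount_eq_card_mul_shellLaw]
      congr 1
      rw [eq_div_iff hm, hKB]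
      linarith [hr]
    rw [delStep, delStepLaw, mul_sub, mul_sum, mul_sum]
    congr 1
    · refine sum_congr rfl fun v hv => ?_
      rw [mul_sum]
      refine sum_congr rfl fun w hw => ?_
      obtain ⟨hvS, hvH, hπvH⟩ := mem_vAA.1 hv
      obtain ⟨hwS, hwH, _⟩ := mem_vDD.1 hw
      exact hterm v w hvS hwS (fun e => hwH (e ▸ hvH)) (fun e => hwH (e ▸ hπvH))
    · refine sum_congr rfl fun v hv => ?_
      rw [mul_sum]
      refine sum_congr rfl fun w hw => ?_
      obtain ⟨hvS, hvH, _⟩ := mem_vBH.1 hv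
      obtain ⟨hwπv, hw'⟩ := mem_erase.1 hw
      obtain ⟨hwS, hwH, _⟩ := mem_vBN.1 hw'
      exact hterm v w hvS hwS (fun e => hwH (e ▸ hvH)) hwπv
  have hmain := levelStep_shellCount hπ hπ' hS H t c x
  rw [shellCount_eq_card_mul_shellLaw (π := π) S H (t + 2) (c + 2) x,
    shellCount_eq_card_mul_shellLaw (π := π) S H (t + 2) c x, hdel x, hdel (x - 1), hdel (x - 2)] at hmain
  apply mul_left_cancel₀ hKpos.ne'
  rw [show ((c : ℝ) + 2) * ((c : ℝ) + 1) * (shellIn π S (t + 2) (c + 2)).card *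
      (-(1 / ((S.card : ℝ) * ((S.card : ℝ) - 2))) *
        (delStepLaw π S H t c x - 2 * delStepLaw π S H t c (x - 1) + delStepLaw π S H t c (x - 2))) =
      -((((c : ℝ) + 2) * ((c : ℝ) + 1) * (shellIn π S (t + 2) (c + 2)).card /
          ((S.card : ℝ) * ((S.card : ℝ) - 2))) * delStepLaw π S H t c x
        - 2 * ((((c : ℝ) + 2) * ((c : ℝ) + 1) * (shellIn π S (t + 2) (c + 2)).card /
          ((S.card : ℝ) * ((S.card : ℝ) - 2))) * delStepLaw π S H t c (x - 1))
        + (((c : ℝ) + 2) * ((c : ℝ) + 1) * (shellIn π S (t + 2) (c + 2)).card /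
          ((S.card : ℝ) * ((S.card : ℝ) - 2))) * delStepLaw π S H t c (x - 2)) by ring]
  rw [← hmain]
  linear_combination (-(shellLaw π S H (t + 2) c x)) * hKB


/-! ### §8 The total-variation (ℓ¹) form of one level step -/

/-- The `ℓ¹`-size, over a finite window `X ⊆ ℤ`, of the second `x`-difference of `f`:
`Σ_{x ∈ X} |f(x) − 2f(x−1) + f(x−2)|`. [cite: Rothvoss2017, §2 (PDF p. 6)] -/
def l1nab2 (X : Finset ℤ) (f : ℤ → ℝ) : ℝ := ∑ x ∈ X, |f x - 2 * f (x - 1) + f (x - 2)|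

omit hπ hπ' in
/-- `l1nab2` is a sum of absolute values, hence nonnegative. [cite: Rothvoss2017, §2 (PDF p. 6)] -/
theorem l1nab2_nonneg (X : Finset ℤ) (f : ℤ → ℝ) : 0 ≤ l1nab2 X f :=
  sum_nonneg fun _ _ => abs_nonneg _

/-- **One level step in total variation.** Over any finite window `X` of values of the block
statistic, `Σ_{x∈X} |law_S(t+2,c+2;x) − law_S(t+2,c;x)| ≤ (1/(|S|(|S|−2))) · [Σ_{AA×DD} ‖∇² law_{S∖2e}(t,c;·)‖_{ℓ¹(X)} + Σ_{BH×BN off-partner} ‖∇² law_{S∖2e}(t,c;·)‖_{ℓ¹(X)}]`: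
the level smoothness of a shell law is controlled by the `x`-smoothness of the two-edge-deleted
shell laws (the triangle inequality applied to `levelStep_shellLaw`; the sign cancellation between
the `AD` and `BB` classes is given away here). [cite: Rothvoss2017, §2 (PDF p. 6)] -/
theorem levelStep_shellLaw_l1 {S : Finset (Fin n)} (hS : ∀ v ∈ S, π v ∈ S) (H : Finset (Fin n))
    (t c : ℕ) (hne : (shellIn π S (t + 2) (c + 2)).Nonempty) (X : Finset ℤ) :
    ∑ x ∈ X, |shellLaw π S H (t + 2) (c + 2) x - shellLaw π S H (t + 2) c x| ≤
      (1 / ((S.card : ℝ) * ((S.card : ℝ) - 2))) *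
        ((∑ v ∈ vAA π S H, ∑ w ∈ vDD π S H, l1nab2 X (shellLaw π (del2 π S v w) H t c)) +
          ∑ v ∈ vBH π S H, ∑ w ∈ (vBN π S H).erase (π v), l1nab2 X (shellLaw π (del2 π S v w) H t c)) := by
  have hm4 : 4 ≤ S.card := by
    obtain ⟨U, hU⟩ := hne
    have := add_le_of_mem_shellIn hπ hS hU
    omega
  have h4 : (4 : ℝ) ≤ S.card := by exact_mod_cast hm4
  have hKpos : 0 < 1 / ((S.card : ℝ) * ((S.card : ℝ) - 2)) := by
    apply div_pos one_pos; exact mul_pos (by linarith) (by linarith)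
  -- abbreviations for the per-pair second differences
  set F : Fin n → Fin n → ℤ → ℝ := fun v w x =>
    shellLaw π (del2 π S v w) H t c x - 2 * shellLaw π (del2 π S v w) H t c (x - 1) +
      shellLaw π (del2 π S v w) H t c (x - 2) with hF
  -- pointwise: |law₂ − law₀|(x) ≤ K · (Σ_AD |F v w x| + Σ_BB |F v w x|)
  have hpt : ∀ x : ℤ, |shellLaw π S H (t + 2) (c + 2) x - shellLaw π S H (t + 2) c x| ≤
      (1 / ((S.card : ℝ) * ((S.card : ℝ) - 2))) *
        ((∑ v ∈ vAA π S H, ∑ w ∈ vDD π S H, |F v w x|) +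
          ∑ v ∈ vBH π S H, ∑ w ∈ (vBN π S H).erase (π v), |F v w x|) := by
    intro x
    have hid := levelStep_shellLaw hπ hπ' hS H t c hne x
    have hexp : delStepLaw π S H t c x - 2 * delStepLaw π S H t c (x - 1) + delStepLaw π S H t c (x - 2) =
        (∑ v ∈ vAA π S H, ∑ w ∈ vDD π S H, F v w x) -
          ∑ v ∈ vBH π S H, ∑ w ∈ (vBN π S H).erase (π v), F v w x := by
      simp only [delStepLaw, hF, sum_add_distrib, sum_sub_distrib, mul_sum, mul_sub]
      ring
    rw [hid, hexp, abs_mul, abs_neg, abs_of_pos hKpos]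
    refine mul_le_mul_of_nonneg_left ?_ hKpos.le
    refine (abs_sub _ _).trans (add_le_add ?_ ?_)
    · exact (abs_sum_le_sum_abs _ _).trans (sum_le_sum fun v _ => abs_sum_le_sum_abs _ _)
    · exact (abs_sum_le_sum_abs _ _).trans (sum_le_sum fun v _ => abs_sum_le_sum_abs _ _)
  -- sum over the window and swap the sums
  calc ∑ x ∈ X, |shellLaw π S H (t + 2) (c + 2) x - shellLaw π S H (t + 2) c x|
      ≤ ∑ x ∈ X, (1 / ((S.card : ℝ) * ((S.card : ℝ) - 2))) *
          ((∑ v ∈ vAA π S H, ∑ w ∈ vDD π S H, |F v w x|) +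
            ∑ v ∈ vBH π S H, ∑ w ∈ (vBN π S H).erase (π v), |F v w x|) := sum_le_sum fun x _ => hpt x
    _ = (1 / ((S.card : ℝ) * ((S.card : ℝ) - 2))) *
        ((∑ v ∈ vAA π S H, ∑ w ∈ vDD π S H, l1nab2 X (shellLaw π (del2 π S v w) H t c)) +
          ∑ v ∈ vBH π S H, ∑ w ∈ (vBN π S H).erase (π v), l1nab2 X (shellLaw π (del2 π S v w) H t c)) := by
      rw [← mul_sum, sum_add_distrib]
      congr 2
      · rw [sum_comm]; refine sum_congr rfl fun v _ => ?_; rw [sum_comm]; rfl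
      · rw [sum_comm]; refine sum_congr rfl fun v _ => ?_; rw [sum_comm]; rfl

/-- **One level step in total variation, uniform form.** If every two-edge-deleted shell law has
`‖∇² law_{S∖2e}(t,c;·)‖_{ℓ¹(X)} ≤ B`, then
`Σ_{x∈X} |law_S(t+2,c+2;x) − law_S(t+2,c;x)| ≤ (|AA|·|DD| + |BH|·|BN|)/(|S|(|S|−2)) · B`
(`|AA| = 2a`, `|DD| = 2d`, `|BH| = |BN| = b` for a matching of `H`-type `(a,b,d)`, so the prefactor is
at most `(4ad + b²)/(4N(N−1)) ≤ h(2N−h)/(4N(N−1))`, `h = |H ∩ S|`, `2N = |S|`).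
[cite: Rothvoss2017, §2 (PDF p. 6)] -/
theorem levelStep_shellLaw_l1_le {S : Finset (Fin n)} (hS : ∀ v ∈ S, π v ∈ S) (H : Finset (Fin n))
    (t c : ℕ) (hne : (shellIn π S (t + 2) (c + 2)).Nonempty) (X : Finset ℤ) {B : ℝ}
    (hB : ∀ v ∈ S, ∀ w ∈ S, l1nab2 X (shellLaw π (del2 π S v w) H t c) ≤ B) :
    ∑ x ∈ X, |shellLaw π S H (t + 2) (c + 2) x - shellLaw π S H (t + 2) c x| ≤
      (((vAA π S H).card : ℝ) * (vDD π S H).card + ((vBH π S H).card : ℝ) * (vBN π S H).card) /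
        ((S.card : ℝ) * ((S.card : ℝ) - 2)) * B := by
  have hm4 : 4 ≤ S.card := by
    obtain ⟨U, hU⟩ := hne
    have := add_le_of_mem_shellIn hπ hS hU
    omega
  have h4 : (4 : ℝ) ≤ S.card := by exact_mod_cast hm4
  have hden : 0 < (S.card : ℝ) * ((S.card : ℝ) - 2) := mul_pos (by linarith) (by linarith)
  have hAA : ∀ v ∈ vAA π S H, v ∈ S := fun v hv => (mem_vAA.1 hv).1
  have hDD : ∀ w ∈ vDD π S H, w ∈ S := fun w hw => (mem_vDD.1 hw).1
  have hBH : ∀ v ∈ vBH π S H, v ∈ S := fun v hv => (mem_vBH.1 hv).1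
  have hBN : ∀ w ∈ vBN π S H, w ∈ S := fun w hw => (mem_vBN.1 hw).1
  refine (levelStep_shellLaw_l1 hπ hπ' hS H t c hne X).trans ?_
  have h1 : ∑ v ∈ vAA π S H, ∑ w ∈ vDD π S H, l1nab2 X (shellLaw π (del2 π S v w) H t c) ≤
      ((vAA π S H).card : ℝ) * (vDD π S H).card * B := by
    calc ∑ v ∈ vAA π S H, ∑ w ∈ vDD π S H, l1nab2 X (shellLaw π (del2 π S v w) H t c)
        ≤ ∑ v ∈ vAA π S H, ∑ w ∈ vDD π S H, B :=
          sum_le_sum fun v hv => sum_le_sum fun w hw => hB v (hAA v hv) w (hDD w hw)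
      _ = ((vAA π S H).card : ℝ) * (vDD π S H).card * B := by
          rw [sum_const, sum_const, nsmul_eq_mul, nsmul_eq_mul]; ring
  have h2 : ∑ v ∈ vBH π S H, ∑ w ∈ (vBN π S H).erase (π v), l1nab2 X (shellLaw π (del2 π S v w) H t c) ≤
      ((vBH π S H).card : ℝ) * (vBN π S H).card * B := by
    calc ∑ v ∈ vBH π S H, ∑ w ∈ (vBN π S H).erase (π v), l1nab2 X (shellLaw π (del2 π S v w) H t c)
        ≤ ∑ v ∈ vBH π S H, ∑ w ∈ vBN π S H, l1nab2 X (shellLaw π (del2 π S v w) H t c) :=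
          sum_le_sum fun v _ => sum_le_sum_of_subset_of_nonneg (erase_subset _ _)
            fun w _ _ => l1nab2_nonneg _ _
      _ ≤ ∑ v ∈ vBH π S H, ∑ w ∈ vBN π S H, B :=
          sum_le_sum fun v hv => sum_le_sum fun w hw => hB v (hBH v hv) w (hBN w hw)
      _ = ((vBH π S H).card : ℝ) * (vBN π S H).card * B := by
          rw [sum_const, sum_const, nsmul_eq_mul, nsmul_eq_mul]; ring
  calc (1 / ((S.card : ℝ) * ((S.card : ℝ) - 2))) *
        ((∑ v ∈ vAA π S H, ∑ w ∈ vDD π S H, l1nab2 X (shellLaw π (del2 π S v w) H t c)) +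
          ∑ v ∈ vBH π S H, ∑ w ∈ (vBN π S H).erase (π v), l1nab2 X (shellLaw π (del2 π S v w) H t c))
      ≤ (1 / ((S.card : ℝ) * ((S.card : ℝ) - 2))) *
        ((((vAA π S H).card : ℝ) * (vDD π S H).card * B) + ((vBH π S H).card : ℝ) * (vBN π S H).card * B) :=
        mul_le_mul_of_nonneg_left (add_le_add h1 h2) (div_pos one_pos hden).le
    _ = _ := by ring


/-! ### §9 The half-set decomposition: every shell law is a mixture of shifted level-`0` laws -/

/-- The admissible half-sets of the ground set `S` at level `c`: `c` vertices of `S` taken from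
pairwise distinct edges. [cite: Rothvoss2017, §2 (PDF p. 6)] -/
def halfSets (π : Fin n → Fin n) (S : Finset (Fin n)) (c : ℕ) : Finset (Finset (Fin n)) :=
  S.powerset.filter fun Y => Y.card = c ∧ ∀ v ∈ Y, π v ∉ Y

/-- The ground set with the edges at `Y` deleted: `S ∖ (Y ∪ πY)`. [cite: Rothvoss2017, §2 (PDF p. 6)] -/
def strip (π : Fin n → Fin n) (S Y : Finset (Fin n)) : Finset (Fin n) := S \ (Y ∪ Y.image π)

omit hπ hπ' in
/-- Membership in `halfSets`. [cite: Rothvoss2017, §2 (PDF p. 6)] -/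
@[simp] theorem mem_halfSets {S Y : Finset (Fin n)} {c : ℕ} :
    Y ∈ halfSets π S c ↔ Y ⊆ S ∧ Y.card = c ∧ ∀ v ∈ Y, π v ∉ Y := by
  simp [halfSets]

omit hπ' in
/-- Membership in `strip`. [cite: Rothvoss2017, §2 (PDF p. 6)] -/
theorem mem_strip {S Y : Finset (Fin n)} {v : Fin n} :
    v ∈ strip π S Y ↔ v ∈ S ∧ v ∉ Y ∧ π v ∉ Y := by
  simp only [strip, mem_sdiff, mem_union, mem_image, not_or]
  constructor
  · rintro ⟨hS, hY, himg⟩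
    exact ⟨hS, hY, fun h => himg ⟨π v, h, hπ v⟩⟩
  · rintro ⟨hS, hY, hπY⟩
    refine ⟨hS, hY, ?_⟩
    rintro ⟨w, hw, rfl⟩
    rw [hπ] at hπY
    exact hπY hw

omit hπ' in
/-- `strip S Y` is stable under `π`. [cite: GodsilMeagher2015, §15.2] -/
theorem strip_stable {S Y : Finset (Fin n)} (hS : ∀ v ∈ S, π v ∈ S) :
    ∀ v ∈ strip π S Y, π v ∈ strip π S Y := by
  intro v hv
  rw [mem_strip hπ] at hv ⊢
  exact ⟨hS v hv.1, hv.2.2, by rw [hπ]; exact hv.2.1⟩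

omit hπ' in
/-- `|strip S Y| + 2c = |S|` for an admissible half-set `Y` of size `c`. [cite: GodsilMeagher2015, §15.2] -/
theorem card_strip {S Y : Finset (Fin n)} (hS : ∀ v ∈ S, π v ∈ S) {c : ℕ} (hY : Y ∈ halfSets π S c) :
    (strip π S Y).card + 2 * c = S.card := by
  obtain ⟨hYS, hYc, hYπ⟩ := mem_halfSets.1 hY
  have hdisj : Disjoint Y (Y.image π) := by
    rw [disjoint_left]
    intro v hv hv'
    obtain ⟨w, hw, hwv⟩ := mem_image.1 hv'
    exact hYπ w hw (hwv ▸ hv)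
  have hsub : Y ∪ Y.image π ⊆ S := by
    refine union_subset hYS fun v hv => ?_
    obtain ⟨w, hw, hwv⟩ := mem_image.1 hv
    exact hwv ▸ hS w (hYS hw)
  have hcard : (Y ∪ Y.image π).card = 2 * c := by
    rw [card_union_of_disjoint hdisj, card_image_of_injective _ (π_injective hπ), hYc]; ring
  rw [strip, card_sdiff_of_subset hsub, hcard]
  have := card_le_card hsub
  rw [hcard] at this
  omega

omit hπ hπ' in
/-- The half vertices of a shell member form an admissible half-set. [cite: Rothvoss2017, §2 (PDF p. 6)] -/
theorem half_mem_halfSets {S : Finset (Fin n)} {t c : ℕ} {U : Finset (Fin n)} (hU : U ∈ shellIn π S t c) :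
    half π U ∈ halfSets π S c := by
  obtain ⟨hUS, _, hUc⟩ := mem_shellIn.1 hU
  refine mem_halfSets.2 ⟨(half_subset (π := π) U).trans hUS, hUc, fun v hv h => ?_⟩
  exact (mem_half.1 hv).2 (half_subset (π := π) U h)

omit hπ' in
/-- **The half-set decomposition.** Grouping the members `U` of `Shell_S(t,c)` by their half-set
`Y = half(U)` and deleting `Y`: `U ∖ Y` is a fully matched cut of size `t − c` of the stripped ground
set `S ∖ (Y ∪ πY)`, i.e. a member of ITS level-`0` shell, and `|U ∩ H| = |(U∖Y) ∩ H| + |Y ∩ H|`. Hence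
`Sh_S(t,c;x) = Σ_{Y ∈ halfSets(S,c)} Sh_{S∖(Y∪πY)}(t−c, 0; x − |Y∩H|)`: every shell law is a mixture of
SHIFTED LEVEL-0 LAWS of sub-ground-sets with `|S|/2 − c` edges (and a level-0 law is the law of
`2·#{HH edges} + #{mixed edges}` among `(t−c)/2` edges drawn without replacement — a hypergeometric
structure). [cite: Rothvoss2017, §2 (PDF p. 6)] -/
theorem shellCount_eq_sum_halfSets {S : Finset (Fin n)} (H : Finset (Fin n)) {t c : ℕ} (hct : c ≤ t)
    (x : ℤ) :
    shellCount π S H t c x =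
      ∑ Y ∈ halfSets π S c, shellCount π (strip π S Y) H (t - c) 0 (x - ((Y ∩ H).card : ℤ)) := by
  unfold shellCount
  rw [← Nat.cast_sum, Nat.cast_inj]
  rw [card_eq_sum_card_fiberwise (f := half π) (t := halfSets π S c)
    (fun U hU => half_mem_halfSets (mem_filter.1 hU).1)]
  refine sum_congr rfl fun Y hY => ?_
  obtain ⟨hYS, hYc, hYπ⟩ := mem_halfSets.1 hY
  -- the fibre over `Y`: `U ↦ U \ Y`, inverse `W ↦ W ∪ Y`
  refine card_nbij' (fun U => U \ Y) (fun W => W ∪ Y) ?_ ?_ ?_ ?_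
  · intro U hU
    simp only [mem_coe, mem_filter, mem_shellIn] at hU ⊢
    obtain ⟨⟨⟨hUS, hUt, hUc⟩, hUx⟩, hUY⟩ := hU
    subst hUY
    have hfull : ∀ w ∈ U \ half π U, π w ∈ U \ half π U := by
      intro w hw
      obtain ⟨hwU, hwh⟩ := mem_sdiff.1 hw
      have hπwU : π w ∈ U := by
        by_contra h
        exact hwh (mem_half.2 ⟨hwU, h⟩)
      refine mem_sdiff.2 ⟨hπwU, fun h => ?_⟩
      have := (mem_half.1 h).2
      rw [hπ] at this
      exact this hwU
    refine ⟨⟨?_, ?_, ?_⟩, ?_⟩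
    · intro w hw
      obtain ⟨hwU, hwh⟩ := mem_sdiff.1 hw
      rw [mem_strip hπ]
      refine ⟨hUS hwU, hwh, fun h => ?_⟩
      -- `π w ∈ half U` would give `π (π w) = w ∉ U`
      have := (mem_half.1 h).2
      rw [hπ] at this
      exact this hwU
    · rw [card_sdiff_of_subset (half_subset (π := π) U), hUt, hUc]
    · rw [card_eq_zero, eq_empty_iff_forall_notMem]
      intro w hw
      exact (mem_half.1 hw).2 (hfull w (mem_half.1 hw).1)
    · have hsplit : ((U ∩ H).card : ℤ) = ((U \ half π U) ∩ H).card + ((half π U ∩ H).card : ℤ) := by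
        rw [← Nat.cast_add, ← card_union_of_disjoint
          (disjoint_of_subset_left inter_subset_left
            (disjoint_of_subset_right inter_subset_left sdiff_disjoint))]
        congr 2
        rw [← union_inter_distrib_right, sdiff_union_of_subset (half_subset (π := π) U)]
      rw [← hUx, hsplit]
      ring
  · intro W hW
    simp only [mem_coe, mem_filter, mem_shellIn] at hW ⊢
    obtain ⟨⟨hWS, hWt, hWc⟩, hWx⟩ := hW
    have hWY : Disjoint W Y := by
      rw [disjoint_left]
      intro w hw hwY
      exact ((mem_strip hπ).1 (hWS hw)).2.1 hwY
    have hWstable : ∀ w ∈ W, π w ∈ W := by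
      intro w hw
      by_contra h
      have : w ∈ half π W := mem_half.2 ⟨hw, h⟩
      rw [card_eq_zero] at hWc
      rw [hWc] at this
      exact notMem_empty _ this
    have hhalf : half π (W ∪ Y) = Y := by
      ext v
      simp only [mem_half, mem_union, not_or]
      constructor
      · rintro ⟨hv | hv, hπW, hπY⟩
        · exact absurd (hWstable v hv) hπW
        · exact hv
      · intro hv
        refine ⟨Or.inr hv, fun h => ?_, hYπ v hv⟩
        have := ((mem_strip hπ).1 (hWS h)).2.2
        rw [hπ] at this
        exact this hv
    refine ⟨⟨⟨?_, ?_, ?_⟩, ?_⟩, hhalf⟩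
    · exact union_subset (fun w hw => ((mem_strip hπ).1 (hWS hw)).1) hYS
    · rw [card_union_of_disjoint hWY, hWt, hYc]; omega
    · rw [hhalf, hYc]
    · have : (((W ∪ Y) ∩ H).card : ℤ) = ((W ∩ H).card : ℤ) + ((Y ∩ H).card : ℤ) := by
        rw [← Nat.cast_add, union_inter_distrib_right, card_union_of_disjoint
          (disjoint_of_subset_left inter_subset_left (disjoint_of_subset_right inter_subset_left hWY))]
      rw [this, hWx]
      ring
  · intro U hU
    simp only [mem_coe, mem_filter] at hU
    rw [← hU.2]
    exact sdiff_union_of_subset (half_subset (π := π) U)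
  · intro W hW
    simp only [mem_coe, mem_filter, mem_shellIn] at hW
    have hWY : Disjoint W Y := by
      rw [disjoint_left]
      intro w hw hwY
      exact ((mem_strip hπ).1 (hW.1.1 hw)).2.1 hwY
    exact union_sdiff_cancel_right hWY

omit hπ' in
/-- At level `0` the block statistic splits by edge type: for a fully matched `W ⊆ S`
(`half(W) = ∅`), `|W ∩ H| = |W ∩ AA| + |W ∩ BH|` and `|W ∩ BH| = |W ∩ BN|` is the number of mixed
edges inside `W`, while `|W ∩ AA|` is twice the number of `HH` edges inside `W` (`AA` is `π`-stable):
`X = 2A′ + B′`. [cite: Rothvoss2017, §2 (PDF p. 6)] -/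
theorem card_inter_eq_of_level_zero {S W : Finset (Fin n)} (H : Finset (Fin n)) (hWS : W ⊆ S)
    (hW : ∀ w ∈ W, π w ∈ W) :
    (W ∩ H).card = (W ∩ vAA π S H).card + (W ∩ vBH π S H).card ∧
      (W ∩ vBH π S H).card = (W ∩ vBN π S H).card := by
  constructor
  · rw [← card_union_of_disjoint]
    · congr 1
      ext w
      simp only [mem_inter, mem_union, mem_vAA, mem_vBH]
      constructor
      · rintro ⟨hwW, hwH⟩
        by_cases h : π w ∈ H
        · exact Or.inl ⟨hwW, hWS hwW, hwH, h⟩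
        · exact Or.inr ⟨hwW, hWS hwW, hwH, h⟩
      · rintro (⟨hwW, _, hwH, _⟩ | ⟨hwW, _, hwH, _⟩) <;> exact ⟨hwW, hwH⟩
    · exact disjoint_of_subset_left inter_subset_right
        (disjoint_of_subset_right inter_subset_right
          (disjoint_filter.2 fun v _ h1 h2 => h2.2 h1.2))
  · -- `w ↦ π w` is a bijection `W ∩ BH → W ∩ BN`
    refine card_nbij' (fun w => π w) (fun w => π w) ?_ ?_ ?_ ?_
    · intro w hw
      simp only [mem_coe, mem_inter, mem_vBH, mem_vBN] at hw ⊢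
      obtain ⟨hwW, hwS, hwH, hπwH⟩ := hw
      exact ⟨hW w hwW, hWS (hW w hwW), hπwH, by rw [hπ]; exact hwH⟩
    · intro w hw
      simp only [mem_coe, mem_inter, mem_vBH, mem_vBN] at hw ⊢
      obtain ⟨hwW, hwS, hwH, hπwH⟩ := hw
      exact ⟨hW w hwW, hWS (hW w hwW), hπwH, by rw [hπ]; exact hwH⟩
    · intro w _; exact hπ w
    · intro w _; exact hπ w


/-! ### §10 Level-`0` shells are edge subsets: representatives, closure, the class-splitting count and
the three-type product (the multivariate hypergeometric structure of `X = 2A′ + B′`) -/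

/-- A transversal of the edges inside `C`: the endpoints `v` with `v < π v`.
[cite: GodsilMeagher2015, §15.2] -/
def reps (π : Fin n → Fin n) (C : Finset (Fin n)) : Finset (Fin n) := C.filter fun v => v < π v

/-- The union of the edges at a set of representatives: `R ∪ πR`. [cite: GodsilMeagher2015, §15.2] -/
def close (π : Fin n → Fin n) (R : Finset (Fin n)) : Finset (Fin n) := R ∪ R.image π

omit hπ hπ' in
/-- Membership in `reps`. [cite: GodsilMeagher2015, §15.2] -/
@[simp] theorem mem_reps {C : Finset (Fin n)} {v : Fin n} : v ∈ reps π C ↔ v ∈ C ∧ v < π v := by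
  simp [reps]

omit hπ hπ' in
/-- `reps C ⊆ C`. [cite: GodsilMeagher2015, §15.2] -/
theorem reps_subset (C : Finset (Fin n)) : reps π C ⊆ C := filter_subset _ _

omit hπ' in
/-- Membership in `close`: `v ∈ R ∪ πR ↔ v ∈ R ∨ π v ∈ R`. [cite: GodsilMeagher2015, §15.2] -/
theorem mem_close {R : Finset (Fin n)} {v : Fin n} : v ∈ close π R ↔ v ∈ R ∨ π v ∈ R := by
  simp only [close, mem_union, mem_image]
  constructor
  · rintro (h | ⟨w, hw, rfl⟩)
    · exact Or.inl h
    · rw [hπ]; exact Or.inr hw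
  · rintro (h | h)
    · exact Or.inl h
    · exact Or.inr ⟨π v, h, hπ v⟩

omit hπ' in
/-- `close R` is stable under `π`. [cite: GodsilMeagher2015, §15.2] -/
theorem close_stable (R : Finset (Fin n)) : ∀ v ∈ close π R, π v ∈ close π R := by
  intro v hv
  rw [mem_close hπ] at hv ⊢
  rw [hπ]
  exact hv.symm

omit hπ' in
/-- `|R ∪ πR| = 2|R|` for a set of representatives. [cite: GodsilMeagher2015, §15.2] -/
theorem card_close {R : Finset (Fin n)} (hR : ∀ v ∈ R, v < π v) : (close π R).card = 2 * R.card := by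
  have hdisj : Disjoint R (R.image π) := by
    rw [disjoint_left]
    intro v hv hv'
    obtain ⟨w, hw, hwv⟩ := mem_image.1 hv'
    have h1 := hR v hv
    have h2 := hR w hw
    rw [← hwv, hπ] at h1
    exact lt_asymm h1 h2
  rw [close, card_union_of_disjoint hdisj, card_image_of_injective _ (π_injective hπ)]; ring

omit hπ' in
/-- `reps (R ∪ πR) = R` for a set of representatives. [cite: GodsilMeagher2015, §15.2] -/
theorem reps_close {R : Finset (Fin n)} (hR : ∀ v ∈ R, v < π v) : reps π (close π R) = R := by
  ext v
  rw [mem_reps, mem_close hπ]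
  constructor
  · rintro ⟨h | h, hv⟩
    · exact h
    · have := hR _ h
      rw [hπ] at this
      exact absurd hv (lt_asymm this)
  · intro h
    exact ⟨Or.inl h, hR v h⟩

/-- A `π`-stable set is the closure of its representatives. [cite: GodsilMeagher2015, §15.2] -/
theorem close_reps {W : Finset (Fin n)} (hW : ∀ w ∈ W, π w ∈ W) : close π (reps π W) = W := by
  ext v
  rw [mem_close hπ, mem_reps, mem_reps, hπ]
  constructor
  · rintro (⟨h, _⟩ | ⟨h, _⟩)
    · exact h
    · have := hW _ h; rwa [hπ] at this
  · intro h
    rcases lt_or_gt_of_ne (hπ' v).symm with hlt | hgt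
    · exact Or.inl ⟨h, hlt⟩
    · exact Or.inr ⟨hW v h, hgt⟩

/-- `2|reps W| = |W|` for a `π`-stable `W`: fully matched sets are unions of edges.
[cite: GodsilMeagher2015, §15.2] -/
theorem two_mul_card_reps {W : Finset (Fin n)} (hW : ∀ w ∈ W, π w ∈ W) :
    2 * (reps π W).card = W.card := by
  rw [← card_close hπ (fun v hv => (mem_reps.1 hv).2), close_reps hπ hπ' hW]

omit hπ hπ' in
/-- Membership in a level-`0` shell: fully matched cuts of size `t` inside `S`.
[cite: Rothvoss2017, §2 (PDF p. 6)] -/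
theorem mem_shellIn_zero {S W : Finset (Fin n)} {t : ℕ} :
    W ∈ shellIn π S t 0 ↔ W ⊆ S ∧ W.card = t ∧ ∀ w ∈ W, π w ∈ W := by
  rw [mem_shellIn, card_eq_zero, eq_empty_iff_forall_notMem]
  simp only [mem_half, not_and, not_not]

/-- **Splitting off a `π`-stable class.** For `π`-stable `C ⊆ S` and any property `P` of the part
outside `C`: `#{W ∈ Shell_S(t,0) : |W ∩ C| = 2k, P(W ∖ C)} = C(|reps C|, k) · #{W′ ∈ Shell_{S∖C}(t−2k,0) : P(W′)}`
(`W ↦ (reps(W ∩ C), W ∖ C)` is a bijection onto `k`-subsets of the edges of `C` × level-`0` cuts of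
`S ∖ C`): inside a fully matched cut the edges of different classes are chosen independently.
[cite: Rothvoss2017, §2 (PDF p. 6)] -/
theorem card_shellIn_zero_split {S C : Finset (Fin n)} (hC : ∀ v ∈ C, π v ∈ C)
    (hCS : C ⊆ S) (P : Finset (Fin n) → Prop) [DecidablePred P] {t k : ℕ} (hk : 2 * k ≤ t) :
    ((shellIn π S t 0).filter fun W => (W ∩ C).card = 2 * k ∧ P (W \ C)).card =
      ((reps π C).card.choose k) * ((shellIn π (S \ C) (t - 2 * k) 0).filter P).card := by
  rw [← card_powersetCard, ← card_product]
  refine card_nbij' (fun W => (reps π (W ∩ C), W \ C)) (fun RW => close π RW.1 ∪ RW.2) ?_ ?_ ?_ ?_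
  · intro W hW
    simp only [mem_coe, mem_filter, mem_shellIn_zero] at hW
    obtain ⟨⟨hWS, hWt, hWst⟩, hWC, hWP⟩ := hW
    have hWCst : ∀ w ∈ W ∩ C, π w ∈ W ∩ C := fun w hw =>
      mem_inter.2 ⟨hWst w (mem_inter.1 hw).1, hC w (mem_inter.1 hw).2⟩
    simp only [mem_coe, mem_product, mem_powersetCard, mem_filter, mem_shellIn_zero]
    refine ⟨⟨fun v hv => mem_reps.2 ⟨(mem_inter.1 (mem_reps.1 hv).1).2, (mem_reps.1 hv).2⟩, ?_⟩,
      ⟨fun v hv => mem_sdiff.2 ⟨hWS (mem_sdiff.1 hv).1, (mem_sdiff.1 hv).2⟩, ?_, ?_⟩, hWP⟩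
    · have := two_mul_card_reps hπ hπ' hWCst
      omega
    · have := card_sdiff_add_card_inter W C
      omega
    · intro w hw
      obtain ⟨hwW, hwC⟩ := mem_sdiff.1 hw
      refine mem_sdiff.2 ⟨hWst w hwW, fun h => hwC ?_⟩
      have := hC _ h
      rwa [hπ] at this
  · rintro ⟨R, W'⟩ hRW
    simp only [mem_coe, mem_product, mem_powersetCard, mem_filter, mem_shellIn_zero] at hRW
    obtain ⟨⟨hRC, hRk⟩, ⟨hW'S, hW't, hW'st⟩, hW'P⟩ := hRW
    have hRlt : ∀ v ∈ R, v < π v := fun v hv => (mem_reps.1 (hRC hv)).2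
    have hclC : close π R ⊆ C := by
      intro v hv
      rcases (mem_close hπ).1 hv with h | h
      · exact reps_subset (π := π) C (hRC h)
      · have := hC _ (reps_subset (π := π) C (hRC h)); rwa [hπ] at this
    have hdisj : Disjoint (close π R) W' :=
      disjoint_of_subset_left hclC (disjoint_of_subset_right hW'S disjoint_sdiff)
    have hinter : (close π R ∪ W') ∩ C = close π R := by
      rw [union_inter_distrib_right, inter_eq_left.2 hclC, ((disjoint_of_subset_left hW'S) sdiff_disjoint
        |> disjoint_iff_inter_eq_empty.1), union_empty]
    have hsdiff : (close π R ∪ W') \ C = W' := by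
      rw [union_sdiff_distrib, sdiff_eq_empty_iff_subset.2 hclC, empty_union]
      exact sdiff_eq_self_of_disjoint ((disjoint_of_subset_left hW'S) sdiff_disjoint)
    simp only [mem_coe, mem_filter, mem_shellIn_zero]
    refine ⟨⟨?_, ?_, ?_⟩, ?_, ?_⟩
    · exact union_subset (hclC.trans hCS) (hW'S.trans sdiff_subset)
    · rw [card_union_of_disjoint hdisj, card_close hπ hRlt, hRk, hW't]; omega
    · intro w hw
      rcases mem_union.1 hw with h | h
      · exact mem_union.2 (Or.inl (close_stable hπ R w h))
      · exact mem_union.2 (Or.inr (hW'st w h))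
    · rw [hinter, card_close hπ hRlt, hRk]
    · rw [hsdiff]; exact hW'P
  · intro W hW
    simp only [mem_coe, mem_filter, mem_shellIn_zero] at hW
    obtain ⟨⟨_, _, hWst⟩, _, _⟩ := hW
    have hWCst : ∀ w ∈ W ∩ C, π w ∈ W ∩ C := fun w hw =>
      mem_inter.2 ⟨hWst w (mem_inter.1 hw).1, hC w (mem_inter.1 hw).2⟩
    show close π (reps π (W ∩ C)) ∪ W \ C = W
    rw [close_reps hπ hπ' hWCst, union_comm, sdiff_union_inter]
  · rintro ⟨R, W'⟩ hRW
    simp only [mem_coe, mem_product, mem_powersetCard, mem_filter, mem_shellIn_zero] at hRW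
    obtain ⟨⟨hRC, _⟩, ⟨hW'S, _, _⟩, _⟩ := hRW
    have hRlt : ∀ v ∈ R, v < π v := fun v hv => (mem_reps.1 (hRC hv)).2
    have hclC : close π R ⊆ C := by
      intro v hv
      rcases (mem_close hπ).1 hv with h | h
      · exact reps_subset (π := π) C (hRC h)
      · have := hC _ (reps_subset (π := π) C (hRC h)); rwa [hπ] at this
    have hinter : (close π R ∪ W') ∩ C = close π R := by
      rw [union_inter_distrib_right, inter_eq_left.2 hclC, ((disjoint_of_subset_left hW'S) sdiff_disjoint
        |> disjoint_iff_inter_eq_empty.1), union_empty]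
    have hsdiff : (close π R ∪ W') \ C = W' := by
      rw [union_sdiff_distrib, sdiff_eq_empty_iff_subset.2 hclC, empty_union]
      exact sdiff_eq_self_of_disjoint ((disjoint_of_subset_left hW'S) sdiff_disjoint)
    show (reps π ((close π R ∪ W') ∩ C), (close π R ∪ W') \ C) = (R, W')
    rw [hinter, hsdiff, reps_close hπ hRlt]

/-- **Counting fully matched cuts.** A `π`-stable `C` has exactly `C(|reps C|, k)` fully matched cuts of
size `2k` (its `k`-subsets of edges). [cite: Rothvoss2017, §2 (PDF p. 6)] -/
theorem card_shellIn_zero {C : Finset (Fin n)} (hC : ∀ v ∈ C, π v ∈ C) (k : ℕ) :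
    (shellIn π C (2 * k) 0).card = (reps π C).card.choose k := by
  have h := card_shellIn_zero_split hπ hπ' hC subset_rfl (fun _ => True) (t := 2 * k) (k := k) le_rfl
  have hfilter : ((shellIn π C (2 * k) 0).filter fun W => (W ∩ C).card = 2 * k ∧ True) =
      shellIn π C (2 * k) 0 := by
    refine filter_true_of_mem fun W hW => ⟨?_, trivial⟩
    obtain ⟨hWC, hWk, _⟩ := mem_shellIn_zero.1 hW
    rw [inter_eq_left.2 hWC, hWk]
  have h1 : (shellIn π (C \ C) (2 * k - 2 * k) 0).card = 1 := by
    rw [sdiff_self, Nat.sub_self, card_eq_one]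
    refine ⟨∅, ?_⟩
    ext W
    simp only [mem_shellIn_zero, bot_eq_empty, subset_empty, card_eq_zero, mem_singleton]
    constructor
    · rintro ⟨h, _, _⟩; exact h
    · rintro rfl; exact ⟨rfl, rfl, fun w hw => absurd hw (notMem_empty _)⟩
  rw [hfilter, filter_true_of_mem (s := shellIn π (C \ C) (2 * k - 2 * k) 0) (p := fun _ => True)
    (fun _ _ => trivial), h1, mul_one] at h
  exact h

omit hπ' in
/-- The type classes are `π`-stable: `AA`. [cite: Rothvoss2017, §2 (PDF p. 5)] -/
theorem vAA_stable (S H : Finset (Fin n)) (hS : ∀ v ∈ S, π v ∈ S) : ∀ v ∈ vAA π S H, π v ∈ vAA π S H := by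
  intro v hv
  obtain ⟨hvS, hvH, hπvH⟩ := mem_vAA.1 hv
  exact mem_vAA.2 ⟨hS v hvS, hπvH, by rw [hπ]; exact hvH⟩

omit hπ' in
/-- The type classes are `π`-stable: the mixed class `BH ∪ BN`. [cite: Rothvoss2017, §2 (PDF p. 5)] -/
theorem vB_stable (S H : Finset (Fin n)) (hS : ∀ v ∈ S, π v ∈ S) :
    ∀ v ∈ vBH π S H ∪ vBN π S H, π v ∈ vBH π S H ∪ vBN π S H := by
  intro v hv
  rcases mem_union.1 hv with h | h
  · obtain ⟨hvS, hvH, hπvH⟩ := mem_vBH.1 h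
    exact mem_union.2 (Or.inr (mem_vBN.2 ⟨hS v hvS, hπvH, by rw [hπ]; exact hvH⟩))
  · obtain ⟨hvS, hvH, hπvH⟩ := mem_vBN.1 h
    exact mem_union.2 (Or.inl (mem_vBH.2 ⟨hS v hvS, hπvH, by rw [hπ]; exact hvH⟩))

omit hπ' in
/-- The type classes are `π`-stable: `DD`. [cite: Rothvoss2017, §2 (PDF p. 5)] -/
theorem vDD_stable (S H : Finset (Fin n)) (hS : ∀ v ∈ S, π v ∈ S) : ∀ v ∈ vDD π S H, π v ∈ vDD π S H := by
  intro v hv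
  obtain ⟨hvS, hvH, hπvH⟩ := mem_vDD.1 hv
  exact mem_vDD.2 ⟨hS v hvS, hπvH, by rw [hπ]; exact hvH⟩

omit hπ hπ' in
/-- Removing the `AA` and mixed classes from `S` leaves exactly the `DD` class.
[cite: Rothvoss2017, §2 (PDF p. 5)] -/
theorem sdiff_vAA_sdiff_vB (S H : Finset (Fin n)) :
    (S \ vAA π S H) \ (vBH π S H ∪ vBN π S H) = vDD π S H := by
  ext v
  simp only [mem_sdiff, mem_union, mem_vAA, mem_vBH, mem_vBN, mem_vDD]
  by_cases h1 : v ∈ H <;> by_cases h2 : π v ∈ H <;> simp [h1, h2]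

/-- **The three-type product (multivariate hypergeometric structure of a level-`0` shell law).** In
`Shell_S(2(α+β+γ), 0)` the number of fully matched cuts with `α` edges of type `HH`, `β` mixed edges (and
hence `γ` edges of type `H̄H̄`) is `C(a,α)·C(b,β)·C(d,γ)`, where `a = |reps AA|`, `b = |reps(BH ∪ BN)|`,
`d = |reps DD|` are the numbers of edges of the three types; with `card_inter_eq_of_level_zero` (`X =
2A′ + B′`) this says: conditionally on the number `A′ = α` of `HH` edges, the number `B′` of mixed edges is
HYPERGEOMETRIC (`β ↦ C(b,β)C(d,s−α−β)`, the coefficients of `hyperGen b d (s−α)` of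
`StablePolynomials.HypergeometricRealRooted`). [cite: Rothvoss2017, §2 (PDF p. 6)] -/
theorem card_shellIn_zero_types {S : Finset (Fin n)} (hS : ∀ v ∈ S, π v ∈ S) (H : Finset (Fin n))
    (α β γ : ℕ) :
    ((shellIn π S (2 * (α + β + γ)) 0).filter fun W =>
        (W ∩ vAA π S H).card = 2 * α ∧ (W ∩ (vBH π S H ∪ vBN π S H)).card = 2 * β).card =
      (reps π (vAA π S H)).card.choose α *
        ((reps π (vBH π S H ∪ vBN π S H)).card.choose β * (reps π (vDD π S H)).card.choose γ) := by
  classical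
  set A := vAA π S H
  set B := vBH π S H ∪ vBN π S H
  have hA : ∀ v ∈ A, π v ∈ A := vAA_stable hπ S H hS
  have hB : ∀ v ∈ B, π v ∈ B := vB_stable hπ S H hS
  have hAS : A ⊆ S := filter_subset _ _
  have hBS : B ⊆ S \ A := by
    intro v hv
    rw [mem_sdiff]
    rcases mem_union.1 hv with h | h
    · obtain ⟨hvS, _, hπvH⟩ := mem_vBH.1 h
      exact ⟨hvS, fun h' => hπvH (mem_vAA.1 h').2.2⟩
    · obtain ⟨hvS, hvH, _⟩ := mem_vBN.1 h
      exact ⟨hvS, fun h' => hvH (mem_vAA.1 h').2.1⟩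
  -- first split off the `AA` class
  have h1 := card_shellIn_zero_split hπ hπ' hA hAS (fun W' => (W' ∩ B).card = 2 * β)
    (t := 2 * (α + β + γ)) (k := α) (by omega)
  have hP : ∀ W ∈ shellIn π S (2 * (α + β + γ)) 0,
      ((W ∩ A).card = 2 * α ∧ (W ∩ B).card = 2 * β) ↔ ((W ∩ A).card = 2 * α ∧ (W \ A ∩ B).card = 2 * β) := by
    intro W _
    have : W \ A ∩ B = W ∩ B := by
      ext v
      simp only [mem_inter, mem_sdiff]
      constructor
      · rintro ⟨⟨hvW, _⟩, hvB⟩; exact ⟨hvW, hvB⟩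
      · rintro ⟨hvW, hvB⟩; exact ⟨⟨hvW, (mem_sdiff.1 (hBS hvB)).2⟩, hvB⟩
    rw [this]
  rw [filter_congr hP, h1]
  congr 1
  -- then the mixed class inside `S ∖ AA`
  have h2 := card_shellIn_zero_split hπ hπ' hB hBS (fun _ => True)
    (t := 2 * (α + β + γ) - 2 * α) (k := β) (by omega)
  have hT : ∀ W ∈ shellIn π (S \ A) (2 * (α + β + γ) - 2 * α) 0,
      (W ∩ B).card = 2 * β ↔ ((W ∩ B).card = 2 * β ∧ True) := fun _ _ => (iff_of_eq (and_true _)).symm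
  rw [filter_congr hT, h2, filter_true_of_mem (fun _ _ => trivial)]
  congr 1
  have hγ : 2 * (α + β + γ) - 2 * α - 2 * β = 2 * γ := by omega
  rw [hγ, show (S \ A) \ B = vDD π S H from sdiff_vAA_sdiff_vB S H]
  exact card_shellIn_zero hπ hπ' (vDD_stable hπ S H hS) γ

end Sizes

end ShellStep

end Literature.Combinatorics.Optimization

end
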